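import Literature.NumberTheory.Sieve.CubicBoxModelDispersionClassBounds
import Literature.NumberTheory.Sieve.CubicBoxModelMainTerm
import HarnessLib

/-!
# The dispersion of the Heath-Brown weight against its box model, PROVED

Topic `Literature/NumberTheory/Sieve`, namespace `Literature.NumberTheory.Sieve.CubicMinorant`
(continuation of `CubicBoxModelDispersionClassBounds.lean`, `RoughModelVarianceExpansion.lean`,
`CubicBoxModelClassSums.lean`, `CubicBoxModelMainTerm.lean`).

For the binary problem `n = p + (x³ + 2y³)` (parity-ideate route `GoldbachHeathBrownDispersion`) the
parity-free part of the argument is the DISPERSION ESTIMATE for the difference `w = f₃ − ũ` of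
Heath-Brown's weight `f₃` [HeathBrownActa2001] and its box model `ũ` against the rough model
`g = g_z`, `z = (log 2N)^B`:
`V = ∑_{N<n≤2N} (∑_{k≤N} w(k) g(n−k))² ≤ δ U² N + C N M²`
as soon as the class sums of `f₃` to the squarefree moduli `d ≤ Q₀(κ, δ)` are within `M` of
`ρ(d, r) U` (`U = ∑ f₃ ≥ κ η² N`).  We PROVE it (`boxModel_dispersion`, VERBATIM the route's crux
«ModelDispersion»; `boxModel_dispersion'` the inlined form) by the dispersion method
[BombieriFriedlanderIwaniecActa1986, §3; HalberstamRichert1974, Thm 2.2/2.5; HeathBrownMoroz2004, §3]: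
opening the square (`abs_variance_sub_mainPart_le`, error `D = √N`), expanding the singular series
over the moduli `m = 2∏_{p∈t} p` (`sum_sum_mul_pairSingSeries_eq`), and bounding the class variances
`Z(m)` in the three ranges `m ≤ Q₀` (hypothesis + class sieve for `ũ`), `Q₀ < m ≤ √L` (Brun–Titchmarsh
and the Fundamental Lemma, Rankin tail `∑_{2∏t > Q₀} ∏ 18/p² ≪ Q₀^{-1/2}`), `m > √L` (cube-root counts)
— the lemmas of `CubicBoxModelDispersionClassBounds.lean`.  This file supplies the growth conditions
in `N` (`eventually_*`) and the assembly.  No new facts.  Written for the parity-ideate cell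
(literature seat g14, 2026-08-27).

## References

* [BombieriFriedlanderIwaniecActa1986] E. Bombieri, J. Friedlander, H. Iwaniec, *Primes in arithmetic
  progressions to large moduli*, Acta Math. 156 (1986), §3 (the dispersion method).
* [HalberstamRichert1974] H. Halberstam, H.-E. Richert, *Sieve Methods*, Thm 2.2, Thm 2.5.
* [HeathBrownMoroz2004] D. R. Heath-Brown, B. Z. Moroz, Proc. LMS (3) 88 (2004), §3 (3.1)–(3.3).
* [HeathBrownActa2001] D. R. Heath-Brown, *Primes represented by x³ + 2y³*, Acta Math. 186 (2001), Thm 1.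
-/

noncomputable section

open Finset Filter Topology
open Literature.NumberTheory.Sieve Literature.NumberTheory.Sieve.CubicPrimes

namespace Literature.NumberTheory.Sieve.CubicMinorant

/-! ### Growth conditions in `N` -/

/-- The sifting level `z = (log 2N)^B → ∞` (`B > 0`). [folklore] -/
private theorem tendsto_roughLevel_two_mul {B : ℝ} (hB : 0 < B) :
    Tendsto (fun N : ℕ => roughLevel B (2 * N)) atTop atTop := by
  have h2N : Tendsto (fun N : ℕ => ((2 * N : ℕ) : ℝ)) atTop atTop :=
    tendsto_natCast_atTop_atTop.comp
      (tendsto_atTop_mono (fun N : ℕ => show id N ≤ 2 * N by dsimp only [id]; omega) tendsto_id)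
  exact ((tendsto_rpow_atTop hB).comp (Real.tendsto_log_atTop.comp h2N)).congr fun N => rfl

/-- Powers of `log(12x³)` against powers of `x`: for `r ≥ 0`, `a > 0` and any `C`, eventually
`C (log(12x³))^r ≤ x^a`. [folklore] -/
private theorem eventually_mul_log_rpow_le_rpow (C r a : ℝ) (hr : 0 ≤ r) (ha : 0 < a) :
    ∀ᶠ x : ℝ in atTop, C * Real.log (12 * x ^ 3) ^ r ≤ x ^ a := by
  set K := |C| * (4 : ℝ) ^ r + 1 with hK
  have hK0 : 0 < K := by positivity
  have hε : 0 < 1 / K := by positivity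
  have hlo := (isLittleO_log_rpow_rpow_atTop r ha).bound hε
  filter_upwards [hlo, eventually_ge_atTop (12 : ℝ)] with x hx hx12
  have hx0 : 0 < x := by linarith
  have hlogx : 0 < Real.log x := Real.log_pos (by linarith)
  have hxa : 0 < x ^ a := Real.rpow_pos_of_pos hx0 _
  rw [Real.norm_of_nonneg (Real.rpow_nonneg hlogx.le _), Real.norm_of_nonneg hxa.le] at hx
  have hlog12 : Real.log 12 ≤ Real.log x := Real.log_le_log (by norm_num) hx12
  have hl3 : Real.log (12 * x ^ 3) = Real.log 12 + 3 * Real.log x := by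
    rw [Real.log_mul (by norm_num) (by positivity), Real.log_pow]; push_cast; ring
  have hl4 : Real.log (12 * x ^ 3) ≤ 4 * Real.log x := by rw [hl3]; linarith
  have hl0 : 0 ≤ Real.log (12 * x ^ 3) := by rw [hl3]; positivity
  have hpow : Real.log (12 * x ^ 3) ^ r ≤ (4 : ℝ) ^ r * Real.log x ^ r := by
    calc Real.log (12 * x ^ 3) ^ r ≤ (4 * Real.log x) ^ r := Real.rpow_le_rpow hl0 hl4 hr
      _ = (4 : ℝ) ^ r * Real.log x ^ r := Real.mul_rpow (by norm_num) hlogx.le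
  have h0 : 0 ≤ Real.log (12 * x ^ 3) ^ r := Real.rpow_nonneg hl0 _
  have h4r : 0 ≤ |C| * (4 : ℝ) ^ r := by positivity
  calc C * Real.log (12 * x ^ 3) ^ r ≤ |C| * Real.log (12 * x ^ 3) ^ r :=
        mul_le_mul_of_nonneg_right (le_abs_self C) h0
    _ ≤ |C| * ((4 : ℝ) ^ r * Real.log x ^ r) := mul_le_mul_of_nonneg_left hpow (abs_nonneg C)
    _ = (|C| * (4 : ℝ) ^ r) * Real.log x ^ r := by ring
    _ ≤ (|C| * (4 : ℝ) ^ r) * (1 / K * x ^ a) := mul_le_mul_of_nonneg_left hx h4r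
    _ = (|C| * (4 : ℝ) ^ r) / K * x ^ a := by ring
    _ ≤ 1 * x ^ a := by
        refine mul_le_mul_of_nonneg_right ?_ hxa.le
        rw [div_le_one hK0, hK]; linarith
    _ = x ^ a := one_mul _

/-- Dictionary `N ↔ X`: `z^K = (log 12X³)^{BK}`, `z = (log 12X³)^B`, `log N ≤ log(12X³)`,
`N = 6X³`, for `N ≥ 1`. [cite: HeathBrownActa2001, Theorem 1 (X³ = N/6)] -/
private theorem roughLevel_facts (B : ℝ) {N : ℕ} (hN : 1 ≤ N) (K : ℕ) :
    roughLevel B (2 * N) ^ K = Real.log (12 * hbX N ^ 3) ^ (B * K) ∧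
      roughLevel B (2 * N) = Real.log (12 * hbX N ^ 3) ^ B ∧
      Real.log N ≤ Real.log (12 * hbX N ^ 3) ∧ 0 ≤ Real.log N ∧
      0 < Real.log (12 * hbX N ^ 3) ∧ (N : ℝ) = 6 * hbX N ^ 3 ∧ 0 ≤ roughLevel B (2 * N) := by
  have hN1 : (1 : ℝ) ≤ N := by exact_mod_cast hN
  have hN6 : (N : ℝ) = 6 * hbX N ^ 3 := by rw [hbX_pow_three]; ring
  have h12 : (12 : ℝ) * hbX N ^ 3 = ((2 * N : ℕ) : ℝ) := (cast_two_mul_eq_twelve_mul_hbX_pow N).symm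
  have hlogpos : 0 < Real.log (12 * hbX N ^ 3) := by
    rw [h12]; push_cast; exact Real.log_pos (by linarith)
  have hz : roughLevel B (2 * N) = Real.log (12 * hbX N ^ 3) ^ B := by
    rw [roughLevel, h12]
  refine ⟨?_, hz, ?_, Real.log_nonneg hN1, hlogpos, hN6, ?_⟩
  · rw [hz, ← Real.rpow_natCast, ← Real.rpow_mul hlogpos.le]
  · rw [h12]; push_cast; exact Real.log_le_log (by positivity) (by linarith)
  · rw [hz]; exact Real.rpow_nonneg hlogpos.le _

/-- **The box side is at most `2Xη`** eventually: `L = ⌊X(1+η)⌋ − ⌊X⌋ ≤ Xη + 1 ≤ 2Xη` once `Xη ≥ 1`.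
[cite: HeathBrownActa2001, Theorem 1 (the box X < x, y ≤ X(1+η) with η = (log X)^{-c})] -/
theorem eventually_hbSide_le_two_mul (c : ℝ) :
    ∀ᶠ N : ℕ in atTop, (hbSide c N : ℝ) ≤ 2 * hbX N * hbEta c N := by
  filter_upwards [(tendsto_hbX_mul_hbEta_atTop c).eventually_ge_atTop 1,
    tendsto_hbX.eventually_gt_atTop 1] with N hXη hX1
  have hX := hbX_nonneg N
  have hη0 : 0 ≤ hbEta c N := by
    unfold hbEta; exact Real.rpow_nonneg (Real.log_pos hX1).le _
  have hY : hbX N ≤ hbX N * (1 + hbEta c N) := by nlinarith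
  have hAM : ⌊hbX N⌋₊ ≤ ⌊hbX N * (1 + hbEta c N)⌋₊ := Nat.floor_le_floor hY
  rw [hbSide_def, Nat.cast_sub hAM]
  have h1 : (⌊hbX N * (1 + hbEta c N)⌋₊ : ℝ) ≤ hbX N * (1 + hbEta c N) := Nat.floor_le (by nlinarith)
  have h2 : hbX N - 1 < (⌊hbX N⌋₊ : ℝ) := by
    have := Nat.lt_floor_add_one (hbX N); linarith
  nlinarith

/-- **The box side is at most `N/6 = X³`** eventually (`L ≤ X(1+η) ≤ 2X ≤ X³`).
[cite: HeathBrownActa2001, Theorem 1 (the box X < x, y ≤ X(1+η) with η = (log X)^{-c})] -/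
theorem eventually_hbSide_le_div_six {c : ℝ} (hc : 0 < c) :
    ∀ᶠ N : ℕ in atTop, (hbSide c N : ℝ) ≤ (N : ℝ) / 6 := by
  filter_upwards [(tendsto_hbEta hc).eventually (eventually_le_nhds one_pos),
    tendsto_hbX.eventually_ge_atTop 2] with N hη1 hX2
  have hX := hbX_nonneg N
  have hL : (hbSide c N : ℝ) ≤ ⌊hbX N * (1 + hbEta c N)⌋₊ := by
    rw [hbSide_def]; exact_mod_cast Nat.sub_le _ _
  have hM : (⌊hbX N * (1 + hbEta c N)⌋₊ : ℝ) ≤ 2 * hbX N := by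
    rcases le_or_gt 0 (hbX N * (1 + hbEta c N)) with h | h
    · exact (Nat.floor_le h).trans (by nlinarith)
    · rw [Nat.floor_of_nonpos h.le, Nat.cast_zero]; positivity
  have hX3 : 2 * hbX N ≤ (N : ℝ) / 6 := by
    rw [← hbX_pow_three]
    have hsq : 4 ≤ hbX N ^ 2 := by nlinarith
    calc 2 * hbX N ≤ 4 * hbX N := by linarith
      _ ≤ hbX N ^ 2 * hbX N := by nlinarith
      _ = hbX N ^ 3 := by ring
  linarith

/-- **The box side is at least `N^{1/12}`** eventually (`L ≥ Xη − 1 ≥ X^{1/2} − 1`, `X^{1/2} = (N/6)^{1/6}`).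
[cite: HeathBrownActa2001, Theorem 1 (the box X < x, y ≤ X(1+η) with η = (log X)^{-c})] -/
theorem eventually_rpow_twelfth_le_hbSide (c : ℝ) :
    ∀ᶠ N : ℕ in atTop, (N : ℝ) ^ ((1 : ℝ) / 12) ≤ hbSide c N := by
  -- `L ≥ X^{1/2} − 1` eventually (as in `eventually_mul_roughLevel_pow_le_hbSide`)
  have ha : ∀ᶠ N : ℕ in atTop, hbX N * hbEta c N - 1 ≤ (hbSide c N : ℝ) := by
    filter_upwards [(tendsto_hbX_mul_hbEta_atTop c).eventually_ge_atTop 0,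
      tendsto_hbX.eventually_gt_atTop 1] with N hN hX1
    have hX := hbX_nonneg N
    have hη0 : 0 ≤ hbEta c N := by
      unfold hbEta; exact Real.rpow_nonneg (Real.log_pos hX1).le _
    have hY : hbX N ≤ hbX N * (1 + hbEta c N) := by nlinarith
    have hAM : ⌊hbX N⌋₊ ≤ ⌊hbX N * (1 + hbEta c N)⌋₊ := Nat.floor_le_floor hY
    rw [hbSide_def, Nat.cast_sub hAM]
    have h1 : hbX N * (1 + hbEta c N) - 1 < (⌊hbX N * (1 + hbEta c N)⌋₊ : ℝ) := Nat.sub_one_lt_floor _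
    have h2 : (⌊hbX N⌋₊ : ℝ) ≤ hbX N := Nat.floor_le hX
    linarith
  have hb_real : ∀ᶠ x : ℝ in atTop, x ^ (1 / 2 : ℝ) ≤ x * Real.log x ^ (-c) := by
    have hlo : ∀ᶠ x : ℝ in atTop, ‖Real.log x ^ c‖ ≤ 1 * ‖x ^ (1 / 2 : ℝ)‖ :=
      (isLittleO_log_rpow_rpow_atTop c (by norm_num : (0 : ℝ) < 1 / 2)).bound one_pos
    filter_upwards [hlo, eventually_gt_atTop (1 : ℝ)] with x hx hx1
    have hlogpos : 0 < Real.log x := Real.log_pos hx1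
    have hLc : 0 < Real.log x ^ c := Real.rpow_pos_of_pos hlogpos c
    rw [one_mul, Real.norm_of_nonneg hLc.le, Real.norm_of_nonneg (Real.rpow_nonneg (by linarith) _)] at hx
    rw [Real.rpow_neg hlogpos.le, ← div_eq_mul_inv, le_div_iff₀ hLc]
    have hxhalf : 0 ≤ x ^ (1 / 2 : ℝ) := Real.rpow_nonneg (by linarith) _
    calc x ^ (1 / 2 : ℝ) * Real.log x ^ c ≤ x ^ (1 / 2 : ℝ) * x ^ (1 / 2 : ℝ) :=
          mul_le_mul_of_nonneg_left hx hxhalf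
      _ = x := by rw [← Real.rpow_add (by linarith)]; norm_num
  have hb : ∀ᶠ N : ℕ in atTop, hbX N ^ (1 / 2 : ℝ) ≤ hbX N * hbEta c N := by
    filter_upwards [tendsto_hbX.eventually hb_real] with N hN
    simpa [hbEta] using hN
  -- `2 x^{1/4} · 6^{1/12}… `: we use `x^{1/4} + 1 ≤ x^{1/2}/1` in the form `2 N^{1/12} ≤ X^{1/2}` for `X ≥ 2^{12}`
  have hc' : ∀ᶠ N : ℕ in atTop, (N : ℝ) ^ ((1 : ℝ) / 12) + 1 ≤ hbX N ^ (1 / 2 : ℝ) := by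
    filter_upwards [tendsto_hbX.eventually_ge_atTop ((2 : ℝ) ^ (12 : ℕ)), eventually_ge_atTop 1]
      with N hX hN1
    have hX0 : 0 < hbX N := by linarith [show (0 : ℝ) < (2 : ℝ) ^ (12 : ℕ) by positivity]
    -- `N = 6 X³ ≤ X⁴/… `: `N^{1/12} ≤ (X^4)^{1/12} = X^{1/3}` once `6 ≤ X`, and `X^{1/3} + 1 ≤ X^{1/2}`
    have hN6 : (N : ℝ) = 6 * hbX N ^ 3 := by rw [hbX_pow_three]; ring
    have hX6 : (6 : ℝ) ≤ hbX N := le_trans (by norm_num) hX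
    have hNX4 : (N : ℝ) ≤ hbX N ^ (4 : ℕ) := by rw [hN6]; nlinarith [pow_pos hX0 3]
    have h13 : (N : ℝ) ^ ((1 : ℝ) / 12) ≤ hbX N ^ ((1 : ℝ) / 3) := by
      calc (N : ℝ) ^ ((1 : ℝ) / 12) ≤ (hbX N ^ (4 : ℕ)) ^ ((1 : ℝ) / 12) :=
            Real.rpow_le_rpow (by positivity) hNX4 (by norm_num)
        _ = hbX N ^ ((1 : ℝ) / 3) := by
            rw [← Real.rpow_natCast, ← Real.rpow_mul hX0.le]; norm_num
    -- `X^{1/3} + 1 ≤ 2 X^{1/3} ≤ X^{1/3} X^{1/6} = X^{1/2}` as `X^{1/6} ≥ 2` for `X ≥ 2^{12}`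
    have h16 : (2 : ℝ) ≤ hbX N ^ ((1 : ℝ) / 6) := by
      calc (2 : ℝ) = ((2 : ℝ) ^ (12 : ℕ)) ^ ((1 : ℝ) / 6) / ((2 : ℝ) ^ (12 : ℕ)) ^ ((1 : ℝ) / 6) * 2 := by
            rw [div_self (Real.rpow_pos_of_pos (by positivity) _).ne', one_mul]
        _ = ((2 : ℝ) ^ (12 : ℕ)) ^ ((1 : ℝ) / 6) / 4 * 2 := by
            congr 2
            rw [← Real.rpow_natCast, ← Real.rpow_mul (by norm_num)]; norm_num
        _ ≤ hbX N ^ ((1 : ℝ) / 6) / 4 * 2 := by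
            gcongr
        _ ≤ hbX N ^ ((1 : ℝ) / 6) := by
            have : 0 ≤ hbX N ^ ((1 : ℝ) / 6) := Real.rpow_nonneg hX0.le _
            linarith
    have h13_1 : (1 : ℝ) ≤ hbX N ^ ((1 : ℝ) / 3) := Real.one_le_rpow (by linarith) (by norm_num)
    have hsplit : hbX N ^ (1 / 2 : ℝ) = hbX N ^ ((1 : ℝ) / 3) * hbX N ^ ((1 : ℝ) / 6) := by
      rw [← Real.rpow_add hX0]; norm_num
    rw [hsplit]
    nlinarith [Real.rpow_nonneg hX0.le ((1 : ℝ) / 3)]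
  filter_upwards [ha, hb, hc'] with N h1 h2 h3
  linarith

/-- **The sifting level is below `√N`** eventually. [folklore] -/
private theorem eventually_roughLevel_le_sqrt {B : ℝ} (hB : 0 < B) :
    ∀ᶠ N : ℕ in atTop, roughLevel B (2 * N) ≤ Real.sqrt N := by
  filter_upwards [tendsto_hbX.eventually (eventually_mul_log_rpow_le_rpow 1 B 1 hB.le one_pos),
    eventually_ge_atTop 1, tendsto_hbX.eventually_ge_atTop 1] with N hN hN1 hX1
  obtain ⟨-, hz, -, -, -, hN6, -⟩ := roughLevel_facts B hN1 0
  rw [one_mul, Real.rpow_one] at hN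
  rw [hz]
  refine hN.trans ((Real.le_sqrt (by linarith) (by positivity)).mpr ?_)
  rw [hN6]; nlinarith

/-- **`z⁴ ≤ ε √N`** eventually. [folklore] -/
private theorem eventually_roughLevel_pow_four_le {B ε : ℝ} (hB : 0 < B) (hε : 0 < ε) :
    ∀ᶠ N : ℕ in atTop, roughLevel B (2 * N) ^ 4 ≤ ε * Real.sqrt N := by
  filter_upwards [tendsto_hbX.eventually
      (eventually_mul_log_rpow_le_rpow (1 / ε) (B * (4 : ℕ)) 1 (by positivity) one_pos),
    eventually_ge_atTop 1, tendsto_hbX.eventually_ge_atTop 1] with N hN hN1 hX1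
  obtain ⟨hz4, -, -, -, -, hN6, -⟩ := roughLevel_facts B hN1 4
  rw [Real.rpow_one, div_mul_eq_mul_div, div_le_iff₀ hε, one_mul] at hN
  rw [hz4]
  refine hN.trans ?_
  rw [mul_comm]
  refine mul_le_mul_of_nonneg_left ((Real.le_sqrt (by linarith) (by positivity)).mpr ?_) hε.le
  rw [hN6]; nlinarith

/-- **`z · e^{−log √N / log z} ≤ ε`** eventually: with `ℓ = log log 2N`, `log z = Bℓ`, `log N ≥ e^ℓ/2`,
and `ℓ² = o(e^ℓ)`. [cite: HalberstamRichert1974, Thm 2.5 (the choice D = √N, s = log D/log z → ∞)] -/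
theorem eventually_roughLevel_mul_exp_neg_le {B ε : ℝ} (hB : 0 < B) (hε : 0 < ε) :
    ∀ᶠ N : ℕ in atTop, roughLevel B (2 * N) *
      Real.exp (-(Real.log (Real.sqrt N) / Real.log (roughLevel B (2 * N)))) ≤ ε := by
  set K := 4 * B ^ 2 + 4 * B * |Real.log ε| + 1 with hK
  have hK0 : 0 < K := by positivity
  have hlo := (Real.isLittleO_pow_exp_atTop (n := 2)).bound (show 0 < 1 / K by positivity)
  have h2N : Tendsto (fun N : ℕ => ((2 * N : ℕ) : ℝ)) atTop atTop :=
    tendsto_natCast_atTop_atTop.comp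
      (tendsto_atTop_mono (fun N : ℕ => show id N ≤ 2 * N by dsimp only [id]; omega) tendsto_id)
  have hℓ : Tendsto (fun N : ℕ => Real.log (Real.log ((2 * N : ℕ) : ℝ))) atTop atTop :=
    Real.tendsto_log_atTop.comp (Real.tendsto_log_atTop.comp h2N)
  filter_upwards [hℓ.eventually hlo, hℓ.eventually_ge_atTop 1, eventually_ge_atTop 2]
    with N hN hℓ1 hN2
  set ℓ := Real.log (Real.log ((2 * N : ℕ) : ℝ)) with hℓdef
  have hN0 : (0 : ℝ) < N := by positivity
  have hN2r : (2 : ℝ) ≤ N := by exact_mod_cast hN2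
  have hlog2N0 : 0 < Real.log ((2 * N : ℕ) : ℝ) := by
    push_cast; exact Real.log_pos (by linarith)
  have hz : roughLevel B (2 * N) = Real.exp (B * ℓ) := by
    rw [roughLevel, Real.rpow_def_of_pos hlog2N0, hℓdef, mul_comm]
  have hlogz : Real.log (roughLevel B (2 * N)) = B * ℓ := by rw [hz, Real.log_exp]
  rw [hlogz, Real.log_sqrt hN0.le, hz, ← Real.exp_add, ← Real.exp_log hε, Real.exp_le_exp]
  have hℓ0 : 0 < ℓ := by linarith
  have hBℓ : 0 < B * ℓ := mul_pos hB hℓ0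
  -- `log N ≥ e^ℓ/2`
  have hlogN : Real.exp ℓ / 2 ≤ Real.log N := by
    rw [hℓdef, Real.exp_log hlog2N0]; push_cast
    rw [Real.log_mul two_ne_zero hN0.ne']
    have : Real.log 2 ≤ Real.log N := Real.log_le_log two_pos hN2r
    linarith
  -- `(4B² + 4B|log ε|) ℓ² ≤ e^ℓ`
  have hmain : (4 * B ^ 2 + 4 * B * |Real.log ε|) * ℓ ^ 2 ≤ Real.exp ℓ := by
    have h := hN
    rw [Real.norm_of_nonneg (pow_nonneg hℓ0.le 2), Real.norm_of_nonneg (Real.exp_pos ℓ).le] at h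
    calc (4 * B ^ 2 + 4 * B * |Real.log ε|) * ℓ ^ 2 ≤ K * ℓ ^ 2 :=
          mul_le_mul_of_nonneg_right (by rw [hK]; linarith) (sq_nonneg ℓ)
      _ ≤ K * (1 / K * Real.exp ℓ) := mul_le_mul_of_nonneg_left h hK0.le
      _ = Real.exp ℓ := by field_simp
  -- `Bℓ − log ε ≤ log N /(2Bℓ)`
  have hkey : B * ℓ - Real.log ε ≤ Real.log N / 2 / (B * ℓ) := by
    rw [le_div_iff₀ hBℓ, le_div_iff₀ two_pos]
    have h1 : -Real.log ε ≤ |Real.log ε| := neg_le_abs _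
    have hℓsq : ℓ ≤ ℓ ^ 2 := by nlinarith
    have s1 : -(B * ℓ * Real.log ε) ≤ B * ℓ ^ 2 * |Real.log ε| := by
      have t1 : B * ℓ * (-Real.log ε) ≤ B * ℓ * |Real.log ε| := mul_le_mul_of_nonneg_left h1 hBℓ.le
      have t2 : B * ℓ * |Real.log ε| ≤ B * ℓ ^ 2 * |Real.log ε| :=
        mul_le_mul_of_nonneg_right (mul_le_mul_of_nonneg_left hℓsq hB.le) (abs_nonneg _)
      linarith
    nlinarith [hmain, hlogN, s1, sq_nonneg B, sq_nonneg ℓ]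
  linarith

/-- **Range-3 growth condition**: for any `a > 0`, eventually
`12 z³ N^{1/3} log N · L√L ≤ a η² N` (`L ≤ 2Xη`, `Xη ≥ X^{1/2}`, powers of `log` are `o(X^{1/4})`).
[cite: HeathBrownMoroz2004, §3 (3.1) (the trivial bound N^{1/3} log N for f₃ is harmless for m > √L)] -/
theorem eventually_range3_growth {c B a : ℝ} (hB : 0 < B) (ha : 0 < a) :
    ∀ᶠ N : ℕ in atTop, 12 * roughLevel B (2 * N) ^ 3 * (N : ℝ) ^ ((1 : ℝ) / 3) * Real.log N *
      ((hbSide c N : ℝ) * Real.sqrt (hbSide c N)) ≤ a * hbEta c N ^ 2 * N := by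
  have hb_real : ∀ᶠ x : ℝ in atTop, x ^ (1 / 2 : ℝ) ≤ x * Real.log x ^ (-c) := by
    have hlo : ∀ᶠ x : ℝ in atTop, ‖Real.log x ^ c‖ ≤ 1 * ‖x ^ (1 / 2 : ℝ)‖ :=
      (isLittleO_log_rpow_rpow_atTop c (by norm_num : (0 : ℝ) < 1 / 2)).bound one_pos
    filter_upwards [hlo, eventually_gt_atTop (1 : ℝ)] with x hx hx1
    have hlogpos : 0 < Real.log x := Real.log_pos hx1
    have hLc : 0 < Real.log x ^ c := Real.rpow_pos_of_pos hlogpos c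
    rw [one_mul, Real.norm_of_nonneg hLc.le, Real.norm_of_nonneg (Real.rpow_nonneg (by linarith) _)] at hx
    rw [Real.rpow_neg hlogpos.le, ← div_eq_mul_inv, le_div_iff₀ hLc]
    have hxhalf : 0 ≤ x ^ (1 / 2 : ℝ) := Real.rpow_nonneg (by linarith) _
    calc x ^ (1 / 2 : ℝ) * Real.log x ^ c ≤ x ^ (1 / 2 : ℝ) * x ^ (1 / 2 : ℝ) :=
          mul_le_mul_of_nonneg_left hx hxhalf
      _ = x := by rw [← Real.rpow_add (by linarith)]; norm_num
  have hb : ∀ᶠ N : ℕ in atTop, hbX N ^ (1 / 2 : ℝ) ≤ hbX N * hbEta c N := by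
    filter_upwards [tendsto_hbX.eventually hb_real] with N hN
    simpa [hbEta] using hN
  have hcC := eventually_mul_log_rpow_le_rpow (16 / a) (B * (3 : ℕ) + 1) (1 / 4) (by positivity)
    (by norm_num)
  filter_upwards [hb, tendsto_hbX.eventually hcC, eventually_hbSide_le_two_mul c,
    eventually_ge_atTop 1, tendsto_hbX.eventually_ge_atTop 1] with N hY hC hL2 hN1 hX1
  obtain ⟨hz3, -, hlogN, hlogN0, hlog0, hN6, hz0⟩ := roughLevel_facts B hN1 3
  -- names
  set X := hbX N with hXdef
  set η := hbEta c N
  set Y := X * η with hYdef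
  set z := roughLevel B (2 * N)
  set L : ℝ := (hbSide c N : ℝ)
  set ℓ := Real.log (12 * X ^ 3) with hℓ
  have hX0 : 0 < X := by linarith
  have hY0 : 0 < Y := lt_of_lt_of_le (Real.rpow_pos_of_pos hX0 _) hY
  have hL0 : 0 ≤ L := Nat.cast_nonneg _
  have hsY0 : 0 < Real.sqrt Y := Real.sqrt_pos.mpr hY0
  -- `N^{1/3} ≤ 2X`
  have hN13 : (N : ℝ) ^ ((1 : ℝ) / 3) ≤ 2 * X := by
    have h : ((N : ℝ) ^ ((1 : ℝ) / 3)) ^ (3 : ℕ) ≤ (2 * X) ^ (3 : ℕ) := by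
      rw [← Real.rpow_natCast, ← Real.rpow_mul (by positivity)]; norm_num; rw [hN6]; nlinarith [pow_pos hX0 3]
    exact (pow_le_pow_iff_left₀ (by positivity) (by positivity) three_ne_zero).mp h
  -- `z³ log N ≤ ℓ^{3B+1}`
  have hzl : z ^ 3 * Real.log N ≤ ℓ ^ (B * (3 : ℕ) + 1) := by
    rw [Real.rpow_add hlog0, Real.rpow_one, hz3]
    exact mul_le_mul_of_nonneg_left hlogN (Real.rpow_nonneg hlog0.le _)
  -- `16 z³ log N ≤ a X^{1/4} ≤ a √Y`
  have hX14 : X ^ ((1 : ℝ) / 4) ≤ Real.sqrt Y := by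
    have h : Real.sqrt (X ^ (1 / 2 : ℝ)) ≤ Real.sqrt Y := Real.sqrt_le_sqrt hY
    rwa [Real.sqrt_eq_rpow, ← Real.rpow_mul hX0.le, show (1 / 2 : ℝ) * (1 / 2) = 1 / 4 by norm_num] at h
  have hkey : 16 * (z ^ 3 * Real.log N) ≤ a * Real.sqrt Y := by
    have h1 : 16 * (z ^ 3 * Real.log N) ≤ 16 * ℓ ^ (B * (3 : ℕ) + 1) :=
      mul_le_mul_of_nonneg_left hzl (by norm_num)
    have h2 : 16 / a * ℓ ^ (B * (3 : ℕ) + 1) ≤ X ^ ((1 : ℝ) / 4) := hC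
    rw [div_mul_eq_mul_div, div_le_iff₀ ha] at h2
    calc 16 * (z ^ 3 * Real.log N) ≤ 16 * ℓ ^ (B * (3 : ℕ) + 1) := h1
      _ ≤ X ^ ((1 : ℝ) / 4) * a := h2
      _ ≤ Real.sqrt Y * a := mul_le_mul_of_nonneg_right hX14 ha.le
      _ = a * Real.sqrt Y := mul_comm _ _
  -- `L √L ≤ (2Y)(2√Y)`
  have hsL : Real.sqrt L ≤ 2 * Real.sqrt Y := by
    calc Real.sqrt L ≤ Real.sqrt (4 * Y) := Real.sqrt_le_sqrt (by linarith)
      _ = 2 * Real.sqrt Y := by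
          rw [Real.sqrt_mul (by norm_num), show (4 : ℝ) = 2 ^ 2 by norm_num, Real.sqrt_sq (by norm_num)]
  have hL2' : L ≤ 2 * Y := by rw [hYdef]; linarith
  have hLL : L * Real.sqrt L ≤ (2 * Y) * (2 * Real.sqrt Y) :=
    mul_le_mul hL2' hsL (Real.sqrt_nonneg _) (by positivity)
  -- assemble: LHS ≤ 12 z³ (2X) log N (4 Y √Y) = 96 X Y √Y (z³ log N) ≤ 6 X Y √Y (a √Y) = 6 a X Y² = a η² N
  have hz30 : 0 ≤ z ^ 3 := pow_nonneg hz0 3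
  calc 12 * z ^ 3 * (N : ℝ) ^ ((1 : ℝ) / 3) * Real.log N * (L * Real.sqrt L)
      ≤ 12 * z ^ 3 * (2 * X) * Real.log N * ((2 * Y) * (2 * Real.sqrt Y)) := by
        refine mul_le_mul ?_ hLL (by positivity) (by positivity)
        exact mul_le_mul_of_nonneg_right (mul_le_mul_of_nonneg_left hN13 (by positivity)) hlogN0
    _ = 6 * X * Y * Real.sqrt Y * (16 * (z ^ 3 * Real.log N)) := by ring
    _ ≤ 6 * X * Y * Real.sqrt Y * (a * Real.sqrt Y) := mul_le_mul_of_nonneg_left hkey (by positivity)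
    _ = 6 * a * X * Y * (Real.sqrt Y * Real.sqrt Y) := by ring
    _ = a * η ^ 2 * N := by rw [Real.mul_self_sqrt hY0.le, hN6, hYdef]; ring

/-! ### Arithmetic of the moduli `m = 2∏_{p∈t} p` -/

/-- For `t` a set of odd primes below `z > 2`: `m = 2∏_{p∈t} p` is squarefree. [folklore] -/
private theorem squarefree_two_mul_prod {z : ℝ} {t : Finset ℕ} (ht : t ⊆ oddPrimesBelow z)
    (hz : 2 < z) : Squarefree (2 * ∏ p ∈ t, p) := by
  have h2 : 2 ∉ t := fun h => (mem_oddPrimesBelow.mp (ht h)).1 rfl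
  have hprod : ∏ p ∈ insert 2 t, p = 2 * ∏ p ∈ t, p := prod_insert h2
  rw [← hprod]
  refine (squarefree_primesProdBelow z).squarefree_of_dvd
    (prod_dvd_prod_of_subset _ _ _ fun p hp => ?_)
  rcases mem_insert.mp hp with rfl | hp
  · exact Nat.mem_primesBelow.mpr ⟨Nat.lt_ceil.mpr (by exact_mod_cast hz), Nat.prime_two⟩
  · exact (mem_oddPrimesBelow.mp (ht hp)).2

/-- For `t` a set of odd primes below `z > 2`: `0 < 2∏_{p∈t} p` and every prime factor of
`2∏_{p∈t} p` is `< z`. [folklore] -/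
private theorem two_mul_prod_facts {z : ℝ} {t : Finset ℕ} (ht : t ⊆ oddPrimesBelow z) (hz : 2 < z) :
    0 < 2 * ∏ p ∈ t, p ∧ ∀ q : ℕ, q.Prime → q ∣ 2 * ∏ p ∈ t, p → (q : ℝ) < z := by
  have hsq := squarefree_two_mul_prod ht hz
  refine ⟨Nat.pos_of_ne_zero hsq.ne_zero, fun q hq hqd => ?_⟩
  have h2 : 2 ∉ t := fun h => (mem_oddPrimesBelow.mp (ht h)).1 rfl
  have hprod : ∏ p ∈ insert 2 t, p = 2 * ∏ p ∈ t, p := prod_insert h2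
  rw [← hprod] at hqd
  have hprime : ∀ p ∈ insert 2 t, p.Prime := by
    intro p hp
    rcases mem_insert.mp hp with rfl | hp
    · exact Nat.prime_two
    · exact Nat.prime_of_mem_primesBelow (mem_oddPrimesBelow.mp (ht hp)).2
  have hmem : q ∈ (∏ p ∈ insert 2 t, p).primeFactors :=
    Nat.mem_primeFactors.mpr ⟨hq, hqd, (prod_pos fun p hp => (hprime p hp).pos).ne'⟩
  rw [Nat.primeFactors_prod hprime] at hmem
  rcases mem_insert.mp hmem with rfl | hmem
  · exact_mod_cast hz
  · have := (Nat.mem_primesBelow.mp (mem_oddPrimesBelow.mp (ht hmem)).2).1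
    have h1 : (q : ℝ) + 1 ≤ (⌈z⌉₊ : ℕ) := by exact_mod_cast this
    have h2 : ((⌈z⌉₊ : ℕ) : ℝ) < z + 1 := Nat.ceil_lt_add_one (by linarith)
    linarith

/-- Members of `oddPrimesBelow z` are primes `≥ 3`. [folklore] -/
private theorem three_le_of_mem_oddPrimesBelow {z : ℝ} {p : ℕ} (hp : p ∈ oddPrimesBelow z) :
    p.Prime ∧ 3 ≤ p := by
  obtain ⟨hp2, hp⟩ := mem_oddPrimesBelow.mp hp
  have hpr := Nat.prime_of_mem_primesBelow hp
  have := hpr.two_le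
  exact ⟨hpr, by omega⟩


/-! ### Real-number book-keeping for the assembly -/

/-- The error budget of Step 1. [folklore] -/
private theorem err_budget {C N Q E z z4 D S U δ : ℝ} (hC : 0 < C) (hN : 0 ≤ N) (hδ : 0 ≤ δ)
    (hQz : Q ≤ z) (hE : 0 ≤ E) (hs3 : z * E ≤ δ / (32 * C)) (hD : D * D = N) (hD0 : 0 ≤ D)
    (hs4 : z4 ≤ δ / (32 * C) * D) (hS0 : 0 ≤ S) (hS : S ≤ 2 * U) :
    C * (N * Q * E + D * z4) * S ^ 2 ≤ δ / 4 * U ^ 2 * N := by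
  have ha : N * Q * E ≤ N * (δ / (32 * C)) := by
    rw [mul_assoc]
    exact mul_le_mul_of_nonneg_left ((mul_le_mul_of_nonneg_right hQz hE).trans hs3) hN
  have hb : D * z4 ≤ N * (δ / (32 * C)) := by
    calc D * z4 ≤ D * (δ / (32 * C) * D) := mul_le_mul_of_nonneg_left hs4 hD0
      _ = N * (δ / (32 * C)) := by rw [← hD]; ring
  have hsq : S ^ 2 ≤ (2 * U) ^ 2 := pow_le_pow_left₀ hS0 hS 2
  calc C * (N * Q * E + D * z4) * S ^ 2
      ≤ C * (N * (δ / (32 * C)) + N * (δ / (32 * C))) * (2 * U) ^ 2 :=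
        mul_le_mul (mul_le_mul_of_nonneg_left (add_le_add ha hb) hC.le) hsq (pow_nonneg hS0 2)
          (by positivity)
    _ = δ / 4 * U ^ 2 * N := by field_simp; ring

/-- Budget of range 1. [folklore] -/
private theorem budget_one {N Q M θ U δ : ℝ} (hN : 0 ≤ N) (hθ0 : 0 ≤ θ) (hθ4 : θ ≤ 1 / 4)
    (hθδ : θ ≤ δ / (144 * Q ^ 2)) (hQ : 0 < Q) :
    2 * N * (Q * (Q * (2 * M ^ 2 + 18 * θ ^ 2 * U ^ 2))) ≤
      4 * Q ^ 2 * N * M ^ 2 + δ / 16 * U ^ 2 * N := by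
  have hθsq : θ ^ 2 ≤ θ * (1 / 4) := by rw [sq]; exact mul_le_mul_of_nonneg_left hθ4 hθ0
  have h36 : 36 * Q ^ 2 * θ ^ 2 ≤ δ / 16 := by
    calc 36 * Q ^ 2 * θ ^ 2 ≤ 36 * Q ^ 2 * (θ * (1 / 4)) :=
          mul_le_mul_of_nonneg_left hθsq (by positivity)
      _ = 9 * Q ^ 2 * θ := by ring
      _ ≤ 9 * Q ^ 2 * (δ / (144 * Q ^ 2)) := mul_le_mul_of_nonneg_left hθδ (by positivity)
      _ = δ / 16 := by field_simp; ring
  have hUN : 0 ≤ U ^ 2 * N := by positivity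
  have h := mul_le_mul_of_nonneg_right h36 hUN
  have e : 2 * N * (Q * (Q * (2 * M ^ 2 + 18 * θ ^ 2 * U ^ 2))) =
      4 * Q ^ 2 * N * M ^ 2 + 36 * Q ^ 2 * θ ^ 2 * (U ^ 2 * N) := by ring
  rw [e]
  linarith

/-- Budget of range 2. [folklore] -/
private theorem budget_two {N G C s U δ : ℝ} (hN : 0 ≤ N) (hG : 0 < G) (hδ : 0 < δ) (hs0 : 0 < s)
    (hs : 24 * G * C / δ ≤ s) :
    2 * N * (3 * G * U ^ 2 * (C / s)) ≤ δ / 4 * U ^ 2 * N := by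
  have h6 : 6 * G * (C / s) ≤ δ / 4 := by
    rw [mul_div_assoc', div_le_iff₀ hs0]
    calc 6 * G * C = δ / 4 * (24 * G * C / δ) := by field_simp; ring
      _ ≤ δ / 4 * s := mul_le_mul_of_nonneg_left hs (by positivity)
  have hUN : 0 ≤ U ^ 2 * N := by positivity
  have e : 2 * N * (3 * G * U ^ 2 * (C / s)) = (6 * G * (C / s)) * (U ^ 2 * N) := by ring
  rw [e]
  calc (6 * G * (C / s)) * (U ^ 2 * N) ≤ δ / 4 * (U ^ 2 * N) := mul_le_mul_of_nonneg_right h6 hUN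
    _ = δ / 4 * U ^ 2 * N := by ring

/-- Budget of range 3 (both halves). [folklore] -/
private theorem budget_three {N c U zc δ : ℝ} (hN : 0 ≤ N) (hU : 0 ≤ U) (h : 6 * c * zc ≤ δ / 8 * U) :
    2 * N * (c * U * (3 * zc)) ≤ δ / 8 * U ^ 2 * N := by
  have e : 2 * N * (c * U * (3 * zc)) = (6 * c * zc) * (U * N) := by ring
  rw [e]
  calc (6 * c * zc) * (U * N) ≤ (δ / 8 * U) * (U * N) :=
        mul_le_mul_of_nonneg_right h (mul_nonneg hU hN)
    _ = δ / 8 * U ^ 2 * N := by ring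

/-- Range 3, model half: `6 c_B z³ ≤ (δ/8) U` from `V ≥ 1/(8Kz³)` and `√L ≥ (1536K/δ) z⁶`. [folklore] -/
private theorem budget_three_model {U L V K z s δ : ℝ} (hL : 0 < L) (hV : 0 < V) (hK : 0 < K)
    (hz : 0 < z) (hδ : 0 < δ) (hU : 0 ≤ U) (hs : s * s = L) (hs0 : 0 < s)
    (hV8 : 1 ≤ V * (8 * K * z ^ 3)) (hsL : 1536 * K / δ * z ^ 6 ≤ s) :
    6 * (2 * U / (L ^ 2 * V) * L * (2 * s)) * z ^ 3 ≤ δ / 8 * U := by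
  have e : 6 * (2 * U / (L ^ 2 * V) * L * (2 * s)) * z ^ 3 = U * (24 * z ^ 3 * s) / (L * V) := by
    field_simp; ring
  rw [e, div_le_iff₀ (mul_pos hL hV)]
  have h1 : 24 * z ^ 3 * s * (8 * K * z ^ 3) ≤ δ / 8 * L := by
    have e2 : 24 * z ^ 3 * s * (8 * K * z ^ 3) = δ / 8 * ((1536 * K / δ * z ^ 6) * s) := by
      field_simp; ring
    rw [e2]
    refine mul_le_mul_of_nonneg_left ?_ (by positivity)
    calc (1536 * K / δ * z ^ 6) * s ≤ s * s := mul_le_mul_of_nonneg_right hsL hs0.le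
      _ = L := hs
  have h8 : 0 < 8 * K * z ^ 3 := by positivity
  have h2 : U * (24 * z ^ 3 * s) * (8 * K * z ^ 3) ≤ δ / 8 * U * (L * V) * (8 * K * z ^ 3) := by
    calc U * (24 * z ^ 3 * s) * (8 * K * z ^ 3) = U * (24 * z ^ 3 * s * (8 * K * z ^ 3)) := by ring
      _ ≤ U * (δ / 8 * L) := mul_le_mul_of_nonneg_left h1 hU
      _ = δ / 8 * U * L * 1 := by ring
      _ ≤ δ / 8 * U * L * (V * (8 * K * z ^ 3)) := mul_le_mul_of_nonneg_left hV8 (by positivity)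
      _ = δ / 8 * U * (L * V) * (8 * K * z ^ 3) := by ring
  exact le_of_mul_le_mul_right h2 h8

/-- The final book-keeping: `V ≤ N·MP + E`, `N·MP ≤ 2N(T₁ + T₂ + T₃)`, the four budgets. [folklore] -/
private theorem dispersion_final {V MP E N U M Q δ T₁ T₂ T₃ b₁ b₂ cA cB z3 : ℝ}
    (hV : V - N * MP ≤ E) (hE : E ≤ δ / 4 * U ^ 2 * N) (hMP : N * MP ≤ 2 * N * (T₁ + (T₂ + T₃)))
    (hT₁ : T₁ ≤ b₁) (hT₂ : T₂ ≤ b₂) (hT₃ : T₃ ≤ (cA + cB) * U * z3)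
    (hb₁ : 2 * N * b₁ ≤ 4 * Q ^ 2 * N * M ^ 2 + δ / 16 * U ^ 2 * N)
    (hb₂ : 2 * N * b₂ ≤ δ / 4 * U ^ 2 * N) (hb₃ : 2 * N * (cA * U * z3) ≤ δ / 8 * U ^ 2 * N)
    (hb₃' : 2 * N * (cB * U * z3) ≤ δ / 8 * U ^ 2 * N) (hN : 0 ≤ N) (hUN : 0 ≤ δ * (U ^ 2 * N)) :
    V ≤ δ * U ^ 2 * N + 4 * Q ^ 2 * N * M ^ 2 := by
  have hN2 : 0 ≤ 2 * N := by positivity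
  have h1 : 2 * N * T₁ ≤ 2 * N * b₁ := mul_le_mul_of_nonneg_left hT₁ hN2
  have h2 : 2 * N * T₂ ≤ 2 * N * b₂ := mul_le_mul_of_nonneg_left hT₂ hN2
  have h3 : 2 * N * T₃ ≤ 2 * N * ((cA + cB) * U * z3) := mul_le_mul_of_nonneg_left hT₃ hN2
  nlinarith [h1, h2, h3, hV, hE, hMP, hb₁, hb₂, hb₃, hb₃', hUN]

/-! ### The dispersion estimate -/

/-- **The dispersion of `f₃ − ũ` against the rough model** (inlined form of `boxModel_dispersion`):
for all `κ, δ > 0` there is `Q₀` such that for all `c, B > 0` there are `C, N₀` with: for `N ≥ N₀` and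
any `M`, if `U = ∑_{k≤N} f₃(k) ≥ κη²N` and the class sums of `f₃` to every squarefree `d ≤ Q₀` are within
`M` of `ρ(d,r)·U`, then `∑_{N<n≤2N} (∑_{k≤N} (f₃(k) − ũ(k)) g(n−k))² ≤ δ U² N + C N M²`.
[cite: BombieriFriedlanderIwaniecActa1986, §3 (the dispersion method); HalberstamRichert1974, Thm 2.5] -/
theorem boxModel_dispersion' :
    ∀ κ δ : ℝ, 0 < κ → 0 < δ → ∃ Q₀ : ℕ, ∀ c B : ℝ, 0 < c → 0 < B → ∃ C : ℝ, ∃ N₀ : ℕ,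
      ∀ N : ℕ, N₀ ≤ N → ∀ M : ℝ,
      κ * hbEta c N ^ 2 * N ≤ ∑ k ∈ Icc 1 N, hbWeight c N k →
      (∀ d : ℕ, 0 < d → d ≤ Q₀ → Squarefree d → ∀ r : ℕ, r < d →
        |(∑ k ∈ (Icc 1 N).filter (fun k : ℕ => k ≡ r [MOD d]), hbWeight c N k) -
            (#{xy ∈ range d ×ˢ range d | xy.1 ^ 3 + 2 * xy.2 ^ 3 ≡ r [MOD d] ∧
                Nat.Coprime (xy.1 ^ 3 + 2 * xy.2 ^ 3) d} : ℝ) /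
              (#{xy ∈ range d ×ˢ range d | Nat.Coprime (xy.1 ^ 3 + 2 * xy.2 ^ 3) d} : ℝ) *
            ∑ k ∈ Icc 1 N, hbWeight c N k| ≤ M) →
      ∑ n ∈ Ioc N (2 * N),
        (∑ k ∈ Icc 1 N,
          (hbWeight c N k -
            (∑ k ∈ Icc 1 N, hbWeight c N k) /
                (#{xy ∈ (Iic ⌊hbX N * (1 + hbEta c N)⌋₊ ×ˢ Iic ⌊hbX N * (1 + hbEta c N)⌋₊).filter
                    (fun xy : ℕ × ℕ => hbX N < xy.1 ∧ (xy.1 : ℝ) ≤ hbX N * (1 + hbEta c N) ∧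
                      hbX N < xy.2 ∧ (xy.2 : ℝ) ≤ hbX N * (1 + hbEta c N)) |
                  Nat.Coprime (xy.1 ^ 3 + 2 * xy.2 ^ 3) (roughPrimorial B (2 * N))} : ℝ) *
              (#{xy ∈ (Iic ⌊hbX N * (1 + hbEta c N)⌋₊ ×ˢ Iic ⌊hbX N * (1 + hbEta c N)⌋₊).filter
                    (fun xy : ℕ × ℕ => hbX N < xy.1 ∧ (xy.1 : ℝ) ≤ hbX N * (1 + hbEta c N) ∧
                      hbX N < xy.2 ∧ (xy.2 : ℝ) ≤ hbX N * (1 + hbEta c N)) |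
                  xy.1 ^ 3 + 2 * xy.2 ^ 3 = k ∧ Nat.Coprime k (roughPrimorial B (2 * N))} : ℝ)) *
            roughModel B (2 * N) (n - k)) ^ 2 ≤
        δ * (∑ k ∈ Icc 1 N, hbWeight c N k) ^ 2 * N + C * N * M ^ 2 := by
  intro κ δ hκ hδ
  -- absolute constants: Brun–Titchmarsh for the class sums of `f₃`, the Rankin tail constant
  obtain ⟨C_BT, L₀, hC_BT, hBT⟩ := sum_hbWeight_modEq_le
  obtain ⟨C_tail, hC_tail, htail⟩ := exists_tail_sum_eighteen_div_sq_le
  set G : ℝ := 96 * C_BT / κ + 4 with hG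
  have hG0 : 0 < G := by positivity
  set Q₀ : ℕ := 2 * ⌈(24 * G * C_tail / δ) ^ 2⌉₊ + 2 with hQ₀
  refine ⟨Q₀, fun c B hc hB => ?_⟩
  have hQ₀pos : (0 : ℝ) < Q₀ := by positivity
  have hQ₀sqrt : 24 * G * C_tail / δ ≤ Real.sqrt ((Q₀ : ℝ) / 2) := by
    refine (Real.le_sqrt (by positivity) (by positivity)).mpr ?_
    have h := Nat.le_ceil ((24 * G * C_tail / δ) ^ 2)
    have hQ : ((Q₀ : ℕ) : ℝ) / 2 = (⌈(24 * G * C_tail / δ) ^ 2⌉₊ : ℝ) + 1 := by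
      rw [hQ₀]; push_cast; ring
    rw [hQ]; linarith
  -- constants depending on `κ, δ, c, B`: the class-sieve constants, the error constant
  set θ₁ : ℝ := min (1 / 4) (δ / (144 * (Q₀ : ℝ) ^ 2)) with hθ₁
  have hθ₁0 : 0 < θ₁ := lt_min (by norm_num) (by positivity)
  have hθ₁4 : θ₁ ≤ 1 / 4 := min_le_left _ _
  have hθ₁δ : θ₁ ≤ δ / (144 * (Q₀ : ℝ) ^ 2) := min_le_right _ _
  obtain ⟨K₃, C₃, hC₃, hclass₃⟩ := exists_classRough_ratio_le hθ₁0
  obtain ⟨K₁, C₁, hC₁, hclass₁⟩ := exists_classRough_ratio_le one_pos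
  obtain ⟨K₂, C₂, hC₂, hbox₂⟩ := exists_boxRough_ratio_le (θ := 1 / 2) (by norm_num)
  obtain ⟨C_pc, hC_pc, hvar⟩ := abs_variance_sub_mainPart_le B
  have hK : 0 < CubicSieve.dimConst := by unfold CubicSieve.dimConst; exact Real.exp_pos _
  -- the eventual conditions
  have e1 := eventually_three_mul_floor_cube_le hc
  have e2 := (tendsto_roughLevel_two_mul hB).eventually_ge_atTop 3
  have e3 := eventually_mul_roughLevel_pow_le_hbSide c (C₃ * Q₀) hB K₃
  have e4 := eventually_mul_roughLevel_pow_le_hbSide c (C₁ ^ 2) hB (2 * K₁)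
  have e5 := eventually_mul_roughLevel_pow_le_hbSide c C₂ hB K₂
  have e6 := eventually_mul_roughLevel_pow_le_hbSide c ((1536 * CubicSieve.dimConst / δ) ^ 2) hB 12
  have e7 := eventually_mul_roughLevel_pow_le_hbSide c (L₀ ^ 2) hB 0
  have e8 := eventually_hbSide_le_two_mul c
  have e9 := eventually_rpow_twelfth_le_hbSide c
  have e10 := eventually_hbSide_le_div_six hc
  have e11 := eventually_range3_growth (c := c) hB (show 0 < δ * κ / 8 by positivity)
  have e12 := eventually_roughLevel_le_sqrt hB
  have e13 := eventually_roughLevel_mul_exp_neg_le hB (show 0 < δ / (32 * C_pc) by positivity)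
  have e14 := eventually_roughLevel_pow_four_le hB (show 0 < δ / (32 * C_pc) by positivity)
  have e15 := eventually_ge_atTop (2 : ℕ)
  obtain ⟨N₀, hN₀⟩ := eventually_atTop.mp (e1.and (e2.and (e3.and (e4.and (e5.and (e6.and (e7.and
    (e8.and (e9.and (e10.and (e11.and (e12.and (e13.and (e14.and e15))))))))))))))
  refine ⟨4 * (Q₀ : ℝ) ^ 2, N₀, fun N hN M hUκ hhyp => ?_⟩
  obtain ⟨hM3, hz3, hL3, hL4, hL5, hL6, hL7, hLη, hLN, hLN6, hr3, hzN, hs3, hs4, hN2⟩ := hN₀ N hN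
  -- the box is the integer box `(A, A+L]²`; `P = P(z)`
  rw [hbBox_eq c N, Ioc_floor_eq_Ioc_add_hbSide c N]
  set z : ℝ := roughLevel B (2 * N) with hz
  set A : ℕ := ⌊hbX N⌋₊ with hA
  set L : ℕ := hbSide c N with hL
  set U : ℝ := ∑ k ∈ Icc 1 N, hbWeight c N k with hU
  have hP : roughPrimorial B (2 * N) = primesProdBelow z := rfl
  rw [hP]
  let R : ℝ := (#{xy ∈ Ioc A (A + L) ×ˢ Ioc A (A + L) |
      Nat.Coprime (xy.1 ^ 3 + 2 * xy.2 ^ 3) (primesProdBelow z)} : ℝ)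
  let ut : ℕ → ℝ := fun k => U / R * (#{xy ∈ Ioc A (A + L) ×ˢ Ioc A (A + L) |
      xy.1 ^ 3 + 2 * xy.2 ^ 3 = k ∧ Nat.Coprime k (primesProdBelow z)} : ℝ)
  let w : ℕ → ℝ := fun k => hbWeight c N k - ut k
  -- basic facts
  have hz2 : (2 : ℝ) ≤ z := le_trans (by norm_num) hz3
  have hz2' : (2 : ℝ) < z := lt_of_lt_of_le (by norm_num) hz3
  have hz1 : (1 : ℝ) ≤ z := le_trans (by norm_num) hz3
  have hz0 : (0 : ℝ) < z := lt_of_lt_of_le (by norm_num) hz3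
  have hN1 : 1 ≤ N := le_trans (by norm_num) hN2
  have hN1r : (1 : ℝ) ≤ N := by exact_mod_cast hN1
  have hN0 : (0 : ℝ) < N := lt_of_lt_of_le one_pos hN1r
  have hU0 : 0 ≤ U := sum_nonneg fun k _ => hbWeight_nonneg c N k
  have hUκ' : δ * κ / 8 * hbEta c N ^ 2 * N ≤ δ / 8 * U := by
    have h := mul_le_mul_of_nonneg_left hUκ (show (0 : ℝ) ≤ δ / 8 by positivity)
    calc δ * κ / 8 * hbEta c N ^ 2 * N = δ / 8 * (κ * hbEta c N ^ 2 * N) := by ring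
      _ ≤ δ / 8 * U := h
  have hL1r : (1 : ℝ) ≤ L := le_trans (Real.one_le_rpow hN1r (by norm_num)) hLN
  have hL1 : 1 ≤ L := by exact_mod_cast hL1r
  have hL0 : (0 : ℝ) < L := lt_of_lt_of_le one_pos hL1r
  have hAM' : A < ⌊hbX N * (1 + hbEta c N)⌋₊ := Nat.sub_pos_iff_lt.mp hL1
  have hAL : A + L = ⌊hbX N * (1 + hbEta c N)⌋₊ := Nat.add_sub_cancel' hAM'.le
  have hM3nat : 3 * ⌊hbX N * (1 + hbEta c N)⌋₊ ^ 3 ≤ N := by exact_mod_cast hM3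
  have hval : ∀ xy ∈ Ioc A (A + L) ×ˢ Ioc A (A + L), xy.1 ^ 3 + 2 * xy.2 ^ 3 ∈ Icc 1 N :=
    pairBox_value_mem_Icc hAL hM3nat
  -- `R ≥ L² V/2 > 0`
  have hV0 : 0 < oneClassProduct z := oneClassProduct_pos z
  have hRabs : |R - (L : ℝ) ^ 2 * oneClassProduct z| ≤ 1 / 2 * ((L : ℝ) ^ 2 * oneClassProduct z) :=
    hbox₂ A A L z hz3 hL5
  have hLV0 : 0 < (L : ℝ) ^ 2 * oneClassProduct z := mul_pos (pow_pos hL0 2) hV0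
  have hR2 : (L : ℝ) ^ 2 * oneClassProduct z / 2 ≤ R := by
    linarith only [(abs_le.mp hRabs).1]
  have hR0 : 0 < R := lt_of_lt_of_le (half_pos hLV0) hR2
  have hUR : U / R ≤ 2 * U / ((L : ℝ) ^ 2 * oneClassProduct z) := by
    rw [div_le_div_iff₀ hR0 hLV0]
    calc U * ((L : ℝ) ^ 2 * oneClassProduct z) = 2 * U * ((L : ℝ) ^ 2 * oneClassProduct z / 2) := by
          ring
      _ ≤ 2 * U * R := mul_le_mul_of_nonneg_left hR2 (mul_nonneg zero_le_two hU0)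
  have hUR0 : 0 ≤ 2 * U / ((L : ℝ) ^ 2 * oneClassProduct z) :=
    div_nonneg (mul_nonneg zero_le_two hU0) hLV0.le
  -- `1 ≤ V · 8K z³`
  have hlog2 : 0 < Real.log 2 := Real.log_pos (by norm_num)
  have hlogz0 : 0 < Real.log z := Real.log_pos (lt_of_lt_of_le (by norm_num) hz3)
  have hlogz_le : Real.log z ≤ z := (Real.log_le_sub_one_of_pos hz0).trans (by linarith only [])
  have hV8 : 1 ≤ oneClassProduct z * (8 * CubicSieve.dimConst * z ^ 3) := by
    have hτ0 : 0 < Real.log z / Real.log 2 := div_pos hlogz0 hlog2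
    have hτ2z : Real.log z / Real.log 2 ≤ 2 * z := by
      have h1 : Real.log z / Real.log 2 ≤ z / Real.log 2 :=
        div_le_div_of_nonneg_right hlogz_le hlog2.le
      have h2 : z / Real.log 2 ≤ 2 * z := by
        rw [div_le_iff₀ hlog2]
        have hl : (1 : ℝ) ≤ 2 * Real.log 2 := by
          have := Real.log_two_gt_d9
          linarith only [this]
        calc z = z * 1 := (mul_one z).symm
          _ ≤ z * (2 * Real.log 2) := mul_le_mul_of_nonneg_left hl hz0.le
          _ = 2 * z * Real.log 2 := by ring
      exact h1.trans h2
    have hKτ : 0 < CubicSieve.dimConst * (Real.log z / Real.log 2) ^ 3 := mul_pos hK (pow_pos hτ0 3)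
    have hVlow : (CubicSieve.dimConst * (Real.log z / Real.log 2) ^ 3)⁻¹ ≤ oneClassProduct z :=
      oneClassProduct_ge hz2
    have h1 : 1 ≤ oneClassProduct z * (CubicSieve.dimConst * (Real.log z / Real.log 2) ^ 3) := by
      have := mul_le_mul_of_nonneg_right hVlow hKτ.le
      rwa [inv_mul_cancel₀ hKτ.ne'] at this
    have h2 : CubicSieve.dimConst * (Real.log z / Real.log 2) ^ 3 ≤
        8 * CubicSieve.dimConst * z ^ 3 := by
      have : (Real.log z / Real.log 2) ^ 3 ≤ (2 * z) ^ 3 := pow_le_pow_left₀ hτ0.le hτ2z 3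
      calc CubicSieve.dimConst * (Real.log z / Real.log 2) ^ 3 ≤ CubicSieve.dimConst * (2 * z) ^ 3 :=
            mul_le_mul_of_nonneg_left this hK.le
        _ = 8 * CubicSieve.dimConst * z ^ 3 := by ring
    exact h1.trans (mul_le_mul_of_nonneg_left h2 hV0.le)
  -- the model: `ũ ≥ 0`, mass `U`, `∑ |w| ≤ 2U`
  have hut0 : ∀ k, 0 ≤ ut k := fun k => boxModel_nonneg _ hU0 hR0.le _ k
  have hmass : ∑ k ∈ Icc 1 N, ut k = U :=
    sum_boxModel_eq_mass _ U (primesProdBelow z) hval hR0.ne'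
  have hwabs0 : 0 ≤ ∑ k ∈ Icc 1 N, |w k| := sum_nonneg fun k _ => abs_nonneg _
  have hwabs : ∑ k ∈ Icc 1 N, |w k| ≤ 2 * U := by
    have h : ∀ k ∈ Icc 1 N, |w k| ≤ hbWeight c N k + ut k := by
      intro k _
      have h1 := hbWeight_nonneg c N k
      have h2 := hut0 k
      have e : w k = hbWeight c N k - ut k := rfl
      rw [e]
      exact abs_sub_le_iff.mpr ⟨by linarith only [h1, h2], by linarith only [h1, h2]⟩
    refine (sum_le_sum h).trans ?_
    rw [sum_add_distrib, hmass, ← hU, two_mul]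
  -- STEP 1: opening the square, error with `D = √N`
  have h1 := hvar N w (Real.sqrt N) hz2 hzN
  rw [← hz, hP] at h1
  have hV := (abs_le.mp h1).2
  have hQz : (primesProdBelow z : ℝ) / (Nat.totient (primesProdBelow z) : ℝ) ≤ z :=
    primesProdBelow_div_totient_le hz2
  have herr : C_pc * ((N : ℝ) * ((primesProdBelow z : ℝ) / (Nat.totient (primesProdBelow z) : ℝ)) *
        Real.exp (-(Real.log (Real.sqrt N) / Real.log z)) + Real.sqrt N * z ^ 4) *
      (∑ k ∈ Icc 1 N, |w k|) ^ 2 ≤ δ / 4 * U ^ 2 * N :=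
    err_budget hC_pc hN0.le hδ.le hQz (Real.exp_pos _).le hs3 (Real.mul_self_sqrt hN0.le)
      (Real.sqrt_nonneg _) hs4 hwabs0 hwabs
  -- STEP 2: the main part over the moduli `2∏t`
  set S' : Finset ℕ := oddPrimesBelow z with hS'
  let F : Finset ℕ → ℝ := fun t => (∏ p ∈ t, (1 / ((p : ℝ) - 2))) *
      ∑ r ∈ range (2 * ∏ p ∈ t, p),
        (∑ k ∈ (Icc 1 N).filter (fun k : ℕ => k ≡ r [MOD 2 * ∏ p ∈ t, p]), w k) ^ 2
  have h2 : ∑ k ∈ Icc 1 N, ∑ k' ∈ Icc 1 N, w k * w k' * pairSingSeries B (2 * N) (max k k' - min k k') =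
      pairSingConst B (2 * N) * ∑ t ∈ S'.powerset, F t :=
    sum_sum_mul_pairSingSeries_eq B (2 * N) w (Icc 1 N) hz2'
  have hκz2 : pairSingConst B (2 * N) ≤ 2 := pairSingConst_le_two B (2 * N)
  -- facts on `S'` and the weights `a_t`
  have hS'p : ∀ p ∈ S', p.Prime := fun p hp => (three_le_of_mem_oddPrimesBelow hp).1
  have hS'3 : ∀ p ∈ S', (3 : ℝ) ≤ p := fun p hp => by
    exact_mod_cast (three_le_of_mem_oddPrimesBelow hp).2
  have ha0 : ∀ t ∈ S'.powerset, 0 ≤ ∏ p ∈ t, (1 / ((p : ℝ) - 2)) := fun t ht =>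
    prod_nonneg fun p hp => by
      have := hS'3 p (mem_powerset.mp ht hp)
      exact div_nonneg zero_le_one (by linarith only [this])
  have ha1 : ∀ t ∈ S'.powerset, ∏ p ∈ t, (1 / ((p : ℝ) - 2)) ≤ 1 := fun t ht =>
    prod_le_one (fun p hp => by
      have := hS'3 p (mem_powerset.mp ht hp)
      exact div_nonneg zero_le_one (by linarith only [this])) fun p hp => by
      have := hS'3 p (mem_powerset.mp ht hp)
      rw [div_le_one (by linarith only [this])]; linarith only [this]
  have hF0 : ∀ t ∈ S'.powerset, 0 ≤ F t := fun t ht =>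
    mul_nonneg (ha0 t ht) (sum_nonneg fun r _ => sq_nonneg _)
  have hsumF0 : 0 ≤ ∑ t ∈ S'.powerset, F t := sum_nonneg hF0
  -- the class sums `A_r = ∑_{k≡r} f₃`, `B_r = ∑_{k≡r} ũ` sum to `U` over `r`
  have hsumA : ∀ m : ℕ, 0 < m →
      ∑ r ∈ range m, ∑ k ∈ (Icc 1 N).filter (fun k : ℕ => k ≡ r [MOD m]), hbWeight c N k = U :=
    fun m hm => sum_range_sum_filter_modEq (Icc 1 N) (hbWeight c N) hm
  have hsumB : ∀ m : ℕ, 0 < m →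
      ∑ r ∈ range m, ∑ k ∈ (Icc 1 N).filter (fun k : ℕ => k ≡ r [MOD m]), ut k = U :=
    fun m hm => (sum_range_sum_filter_modEq (Icc 1 N) ut hm).trans hmass
  -- RANGE 1 (`2∏t ≤ Q₀`): hypothesis for `f₃`, class sieve for `ũ`
  have hR1 : ∀ t ∈ S'.powerset.filter (fun t => 2 * ∏ p ∈ t, p ≤ Q₀),
      F t ≤ (Q₀ : ℝ) * (2 * M ^ 2 + 18 * θ₁ ^ 2 * U ^ 2) := by
    intro t ht'
    obtain ⟨htS, hmQ⟩ := mem_filter.mp ht'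
    have ht : t ⊆ oddPrimesBelow z := mem_powerset.mp htS
    obtain ⟨hm0, hdz⟩ := two_mul_prod_facts ht hz2'
    have hsq := squarefree_two_mul_prod ht hz2'
    have hm0r : (0 : ℝ) < ((2 * ∏ p ∈ t, p : ℕ) : ℝ) := by exact_mod_cast hm0
    have hmQr : ((2 * ∏ p ∈ t, p : ℕ) : ℝ) ≤ Q₀ := by exact_mod_cast hmQ
    -- growth condition of the class sieve at `θ₁`
    have hgrow : C₃ * z ^ K₃ ≤ (L : ℝ) / ((2 * ∏ p ∈ t, p : ℕ) : ℝ) := by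
      rw [le_div_iff₀ hm0r]
      calc C₃ * z ^ K₃ * ((2 * ∏ p ∈ t, p : ℕ) : ℝ) ≤ C₃ * z ^ K₃ * Q₀ :=
            mul_le_mul_of_nonneg_left hmQr (mul_nonneg hC₃.le (pow_nonneg hz0.le _))
        _ = C₃ * Q₀ * z ^ K₃ := by ring
        _ ≤ L := hL3
    have hclass : ∀ a b : ℕ, Nat.Coprime (a ^ 3 + 2 * b ^ 3) (2 * ∏ p ∈ t, p) →
        |(#{xy ∈ classBoxPairs A A L (2 * ∏ p ∈ t, p) a b |
            (xy.1 ^ 3 + 2 * xy.2 ^ 3).Coprime (primesProdBelow z)} : ℝ) -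
          ((L : ℝ) / ((2 * ∏ p ∈ t, p : ℕ) : ℝ)) ^ 2 * classSieveProduct (2 * ∏ p ∈ t, p) z| ≤
          θ₁ * (((L : ℝ) / ((2 * ∏ p ∈ t, p : ℕ) : ℝ)) ^ 2 * classSieveProduct (2 * ∏ p ∈ t, p) z) :=
      fun a b hab => hclass₃ A A L _ a b z hm0 hab hz3 hgrow
    have hv : ∀ r, r < 2 * ∏ p ∈ t, p →
        |∑ k ∈ (Icc 1 N).filter (fun k : ℕ => k ≡ r [MOD 2 * ∏ p ∈ t, p]), ut k -
          (fun r : ℕ => (#{xy ∈ range (2 * ∏ p ∈ t, p) ×ˢ range (2 * ∏ p ∈ t, p) |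
              xy.1 ^ 3 + 2 * xy.2 ^ 3 ≡ r [MOD 2 * ∏ p ∈ t, p] ∧
                Nat.Coprime (xy.1 ^ 3 + 2 * xy.2 ^ 3) (2 * ∏ p ∈ t, p)} : ℝ) /
            (#{xy ∈ range (2 * ∏ p ∈ t, p) ×ˢ range (2 * ∏ p ∈ t, p) |
              Nat.Coprime (xy.1 ^ 3 + 2 * xy.2 ^ 3) (2 * ∏ p ∈ t, p)} : ℝ)) r * U| ≤ 3 * θ₁ * U :=
      fun r _ => abs_sum_boxModel_filter_sub_le hm0 hL1 hdz hθ₁0 hθ₁4 hU0 hval hclass r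
    have hu : ∀ r, r < 2 * ∏ p ∈ t, p →
        |∑ k ∈ (Icc 1 N).filter (fun k : ℕ => k ≡ r [MOD 2 * ∏ p ∈ t, p]), hbWeight c N k -
          (fun r : ℕ => (#{xy ∈ range (2 * ∏ p ∈ t, p) ×ˢ range (2 * ∏ p ∈ t, p) |
              xy.1 ^ 3 + 2 * xy.2 ^ 3 ≡ r [MOD 2 * ∏ p ∈ t, p] ∧
                Nat.Coprime (xy.1 ^ 3 + 2 * xy.2 ^ 3) (2 * ∏ p ∈ t, p)} : ℝ) /
            (#{xy ∈ range (2 * ∏ p ∈ t, p) ×ˢ range (2 * ∏ p ∈ t, p) |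
              Nat.Coprime (xy.1 ^ 3 + 2 * xy.2 ^ 3) (2 * ∏ p ∈ t, p)} : ℝ)) r * U| ≤ M :=
      fun r hr => hhyp _ hm0 hmQ hsq r hr
    have hZ : ∑ r ∈ range (2 * ∏ p ∈ t, p),
        (∑ k ∈ (Icc 1 N).filter (fun k : ℕ => k ≡ r [MOD 2 * ∏ p ∈ t, p]), w k) ^ 2 ≤
        ((2 * ∏ p ∈ t, p : ℕ) : ℝ) * (2 * M ^ 2 + 2 * (3 * θ₁) ^ 2 * U ^ 2) :=
      classVariance_le_of_close (Icc 1 N) (hbWeight c N) ut _ hu hv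
    have hB0 : 0 ≤ 2 * M ^ 2 + 18 * θ₁ ^ 2 * U ^ 2 := by positivity
    have hZ' : ∑ r ∈ range (2 * ∏ p ∈ t, p),
        (∑ k ∈ (Icc 1 N).filter (fun k : ℕ => k ≡ r [MOD 2 * ∏ p ∈ t, p]), w k) ^ 2 ≤
        (Q₀ : ℝ) * (2 * M ^ 2 + 18 * θ₁ ^ 2 * U ^ 2) := by
      refine hZ.trans ?_
      rw [show 2 * (3 * θ₁) ^ 2 * U ^ 2 = 18 * θ₁ ^ 2 * U ^ 2 by ring]
      exact mul_le_mul_of_nonneg_right hmQr hB0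
    have key : (∏ p ∈ t, (1 / ((p : ℝ) - 2))) * ∑ r ∈ range (2 * ∏ p ∈ t, p),
        (∑ k ∈ (Icc 1 N).filter (fun k : ℕ => k ≡ r [MOD 2 * ∏ p ∈ t, p]), w k) ^ 2 ≤
        1 * ((Q₀ : ℝ) * (2 * M ^ 2 + 18 * θ₁ ^ 2 * U ^ 2)) :=
      mul_le_mul (ha1 t htS) hZ' (sum_nonneg fun r _ => sq_nonneg _) zero_le_one
    rw [one_mul] at key
    exact key
  have hR1sum : ∑ t ∈ S'.powerset.filter (fun t => 2 * ∏ p ∈ t, p ≤ Q₀), F t ≤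
      (Q₀ : ℝ) * ((Q₀ : ℝ) * (2 * M ^ 2 + 18 * θ₁ ^ 2 * U ^ 2)) := by
    refine (sum_le_card_nsmul _ _ _ hR1).trans ?_
    rw [nsmul_eq_mul]
    refine mul_le_mul_of_nonneg_right ?_ (by positivity)
    exact_mod_cast card_powerset_filter_two_mul_prod_le hS'p Q₀
  -- RANGE 2 (`Q₀ < 2∏t`, `(2∏t)² ≤ L`): Brun–Titchmarsh and the Fundamental Lemma
  have hL₀ : L₀ ^ 2 ≤ (L : ℝ) := by
    have h := hL7
    rw [pow_zero, mul_one] at h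
    exact h
  have hR2t : ∀ t ∈ (S'.powerset.filter (fun t => ¬ 2 * ∏ p ∈ t, p ≤ Q₀)).filter
      (fun t => (2 * ∏ p ∈ t, p) ^ 2 ≤ L),
      F t ≤ 3 * G * U ^ 2 * ∏ p ∈ t, ((18 : ℝ) / (p : ℝ) ^ 2) := by
    intro t ht'
    obtain ⟨ht'', hm2L⟩ := mem_filter.mp ht'
    obtain ⟨htS, -⟩ := mem_filter.mp ht''
    have ht : t ⊆ oddPrimesBelow z := mem_powerset.mp htS
    obtain ⟨hm0, -⟩ := two_mul_prod_facts ht hz2'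
    have hm0r : (0 : ℝ) < ((2 * ∏ p ∈ t, p : ℕ) : ℝ) := by exact_mod_cast hm0
    have hm1r : (1 : ℝ) ≤ ((2 * ∏ p ∈ t, p : ℕ) : ℝ) := by exact_mod_cast hm0
    have hm2 : (((2 * ∏ p ∈ t, p : ℕ) : ℝ)) ^ 2 ≤ (L : ℝ) := by exact_mod_cast hm2L
    have hmL : ((2 * ∏ p ∈ t, p : ℕ) : ℝ) ≤ L := by
      refine le_trans ?_ hm2
      calc ((2 * ∏ p ∈ t, p : ℕ) : ℝ) = ((2 * ∏ p ∈ t, p : ℕ) : ℝ) * 1 := (mul_one _).symm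
        _ ≤ ((2 * ∏ p ∈ t, p : ℕ) : ℝ) * ((2 * ∏ p ∈ t, p : ℕ) : ℝ) :=
            mul_le_mul_of_nonneg_left hm1r hm0r.le
        _ = (((2 * ∏ p ∈ t, p : ℕ) : ℝ)) ^ 2 := (sq _).symm
    have hmN : ((2 * ∏ p ∈ t, p : ℕ) : ℝ) ≤ (N : ℝ) / 6 := hmL.trans hLN6
    -- `C₁ z^{K₁} ≤ L/m` from `C₁² z^{2K₁} ≤ L` and `m² ≤ L`
    have hgrowth : C₁ * z ^ K₁ ≤ (L : ℝ) / ((2 * ∏ p ∈ t, p : ℕ) : ℝ) := by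
      rw [le_div_iff₀ hm0r]
      have hx : C₁ * z ^ K₁ ≤ Real.sqrt L := by
        refine (Real.le_sqrt (mul_nonneg hC₁.le (pow_nonneg hz0.le _)) hL0.le).mpr ?_
        rw [mul_pow, ← pow_mul, mul_comm K₁ 2]; exact hL4
      have hy : ((2 * ∏ p ∈ t, p : ℕ) : ℝ) ≤ Real.sqrt L :=
        (Real.le_sqrt hm0r.le hL0.le).mpr hm2
      calc C₁ * z ^ K₁ * ((2 * ∏ p ∈ t, p : ℕ) : ℝ) ≤ Real.sqrt L * Real.sqrt L :=
            mul_le_mul hx hy hm0r.le (Real.sqrt_nonneg _)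
        _ = L := Real.mul_self_sqrt hL0.le
    have hA : ∀ r ∈ range (2 * ∏ p ∈ t, p),
        ∑ k ∈ (Icc 1 N).filter (fun k : ℕ => k ≡ r [MOD 2 * ∏ p ∈ t, p]), hbWeight c N k ≤
          96 * C_BT / κ * U * 6 ^ (#t + 1) / ((2 * ∏ p ∈ t, p : ℕ) : ℝ) := fun r _ =>
      sum_hbWeight_modEq_le_mid hBT hC_BT.le ht hκ hN2 hUκ hLη hLN hm2 hL₀ hmN r
    have hB : ∀ r ∈ range (2 * ∏ p ∈ t, p),
        ∑ k ∈ (Icc 1 N).filter (fun k : ℕ => k ≡ r [MOD 2 * ∏ p ∈ t, p]), ut k ≤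
          4 * U * 6 ^ (#t + 1) / ((2 * ∏ p ∈ t, p : ℕ) : ℝ) := fun r _ =>
      sum_boxModel_modEq_le_mid hclass₁ ht hz3 hU0 hL1 hval hgrowth hR2 r
    have hA0 : ∀ r ∈ range (2 * ∏ p ∈ t, p),
        0 ≤ ∑ k ∈ (Icc 1 N).filter (fun k : ℕ => k ≡ r [MOD 2 * ∏ p ∈ t, p]), hbWeight c N k :=
      fun r _ => sum_nonneg fun k _ => hbWeight_nonneg c N k
    have hB0 : ∀ r ∈ range (2 * ∏ p ∈ t, p),
        0 ≤ ∑ k ∈ (Icc 1 N).filter (fun k : ℕ => k ≡ r [MOD 2 * ∏ p ∈ t, p]), ut k :=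
      fun r _ => sum_nonneg fun k _ => hut0 k
    have hZ : ∑ r ∈ range (2 * ∏ p ∈ t, p),
        (∑ k ∈ (Icc 1 N).filter (fun k : ℕ => k ≡ r [MOD 2 * ∏ p ∈ t, p]), w k) ^ 2 ≤
        G * U ^ 2 * 6 ^ (#t + 1) / ((2 * ∏ p ∈ t, p : ℕ) : ℝ) := by
      have h := sum_sq_sub_le_of_le (range (2 * ∏ p ∈ t, p)) hA0 hA hB0 hB
      rw [hsumA _ hm0, hsumB _ hm0] at h
      have e : ∑ r ∈ range (2 * ∏ p ∈ t, p),
          (∑ k ∈ (Icc 1 N).filter (fun k : ℕ => k ≡ r [MOD 2 * ∏ p ∈ t, p]), w k) ^ 2 =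
          ∑ r ∈ range (2 * ∏ p ∈ t, p),
            (∑ k ∈ (Icc 1 N).filter (fun k : ℕ => k ≡ r [MOD 2 * ∏ p ∈ t, p]), hbWeight c N k -
              ∑ k ∈ (Icc 1 N).filter (fun k : ℕ => k ≡ r [MOD 2 * ∏ p ∈ t, p]), ut k) ^ 2 := by
        refine sum_congr rfl fun r _ => ?_
        rw [← sum_sub_distrib]
      rw [e]
      refine h.trans (le_of_eq ?_)
      rw [hG]; ring
    have key : (∏ p ∈ t, (1 / ((p : ℝ) - 2))) * ∑ r ∈ range (2 * ∏ p ∈ t, p),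
        (∑ k ∈ (Icc 1 N).filter (fun k : ℕ => k ≡ r [MOD 2 * ∏ p ∈ t, p]), w k) ^ 2 ≤
        (∏ p ∈ t, (1 / ((p : ℝ) - 2))) * (G * U ^ 2 * 6 ^ (#t + 1) / ((2 * ∏ p ∈ t, p : ℕ) : ℝ)) :=
      mul_le_mul_of_nonneg_left hZ (ha0 t htS)
    have e1 : (∏ p ∈ t, (1 / ((p : ℝ) - 2))) * (G * U ^ 2 * 6 ^ (#t + 1) / ((2 * ∏ p ∈ t, p : ℕ) : ℝ)) =
        G * U ^ 2 * ((∏ p ∈ t, (1 / ((p : ℝ) - 2))) * (6 : ℝ) ^ (#t + 1) /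
          ((2 * ∏ p ∈ t, p : ℕ) : ℝ)) := by ring
    have key2 : G * U ^ 2 * ((∏ p ∈ t, (1 / ((p : ℝ) - 2))) * (6 : ℝ) ^ (#t + 1) /
          ((2 * ∏ p ∈ t, p : ℕ) : ℝ)) ≤ G * U ^ 2 * (3 * ∏ p ∈ t, ((18 : ℝ) / (p : ℝ) ^ 2)) :=
      mul_le_mul_of_nonneg_left (prod_inv_sub_two_mul_le ht) (mul_nonneg hG0.le (sq_nonneg U))
    have e2 : G * U ^ 2 * (3 * ∏ p ∈ t, ((18 : ℝ) / (p : ℝ) ^ 2)) =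
        3 * G * U ^ 2 * ∏ p ∈ t, ((18 : ℝ) / (p : ℝ) ^ 2) := by ring
    rw [e1] at key
    rw [e2] at key2
    exact key.trans key2
  have hsq0 : 0 < Real.sqrt ((Q₀ : ℝ) / 2) := Real.sqrt_pos.mpr (half_pos hQ₀pos)
  have hR2sum : ∑ t ∈ (S'.powerset.filter (fun t => ¬ 2 * ∏ p ∈ t, p ≤ Q₀)).filter
      (fun t => (2 * ∏ p ∈ t, p) ^ 2 ≤ L), F t ≤ 3 * G * U ^ 2 * (C_tail / Real.sqrt ((Q₀ : ℝ) / 2)) := by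
    refine (sum_le_sum hR2t).trans ?_
    rw [← mul_sum]
    refine mul_le_mul_of_nonneg_left ?_ (mul_nonneg (mul_nonneg zero_le_three hG0.le) (sq_nonneg U))
    have hsub : (S'.powerset.filter (fun t => ¬ 2 * ∏ p ∈ t, p ≤ Q₀)).filter
        (fun t => (2 * ∏ p ∈ t, p) ^ 2 ≤ L) ⊆
        S'.powerset.filter (fun t => (Q₀ : ℝ) / 2 < ∏ p ∈ t, ((p : ℕ) : ℝ)) := by
      intro t ht
      obtain ⟨ht'', -⟩ := mem_filter.mp ht
      obtain ⟨htS, hmQ⟩ := mem_filter.mp ht''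
      refine mem_filter.mpr ⟨htS, ?_⟩
      have h : (Q₀ : ℝ) < ((2 * ∏ p ∈ t, p : ℕ) : ℝ) := by exact_mod_cast not_le.mp hmQ
      push_cast at h
      linarith only [h]
    refine (sum_le_sum_of_subset_of_nonneg hsub fun t _ _ =>
      prod_nonneg fun p _ => div_nonneg (by norm_num) (sq_nonneg _)).trans ?_
    exact htail S' ((Q₀ : ℝ) / 2) (half_pos hQ₀pos)
  -- RANGE 3 (`(2∏t)² > L`): cube-root counts
  obtain ⟨cA, hcA⟩ : ∃ cA : ℝ, cA = 2 * ((N : ℝ) ^ ((1 : ℝ) / 3) * Real.log N) *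
      ((L : ℝ) * Real.sqrt L) := ⟨_, rfl⟩
  obtain ⟨cB, hcB⟩ : ∃ cB : ℝ, cB = 2 * U / ((L : ℝ) ^ 2 * oneClassProduct z) * (L : ℝ) *
      (2 * Real.sqrt L) := ⟨_, rfl⟩
  have hlogN0 : 0 ≤ Real.log N := Real.log_nonneg hN1r
  have hN13 : 0 ≤ (N : ℝ) ^ ((1 : ℝ) / 3) * Real.log N := mul_nonneg (Real.rpow_nonneg hN0.le _) hlogN0
  have hsL0 : 0 < Real.sqrt L := Real.sqrt_pos.mpr hL0
  have hsL1 : 1 ≤ Real.sqrt L := by rw [← Real.sqrt_one]; exact Real.sqrt_le_sqrt hL1r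
  have hcA0 : 0 ≤ cA := by
    rw [hcA]; exact mul_nonneg (mul_nonneg zero_le_two hN13) (mul_nonneg hL0.le hsL0.le)
  have hcB0 : 0 ≤ cB := by
    rw [hcB]; exact mul_nonneg (mul_nonneg hUR0 hL0.le) (mul_nonneg zero_le_two hsL0.le)
  have hR3t : ∀ t ∈ (S'.powerset.filter (fun t => ¬ 2 * ∏ p ∈ t, p ≤ Q₀)).filter
      (fun t => ¬ (2 * ∏ p ∈ t, p) ^ 2 ≤ L),
      F t ≤ (cA + cB) * U * (3 * ∏ p ∈ t, ((3 : ℝ) / ((p : ℝ) - 2))) := by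
    intro t ht'
    obtain ⟨ht'', hmL⟩ := mem_filter.mp ht'
    obtain ⟨htS, -⟩ := mem_filter.mp ht''
    have ht : t ⊆ oddPrimesBelow z := mem_powerset.mp htS
    obtain ⟨hm0, -⟩ := two_mul_prod_facts ht hz2'
    have hm0r : (0 : ℝ) < ((2 * ∏ p ∈ t, p : ℕ) : ℝ) := by exact_mod_cast hm0
    -- `L/m + 1 ≤ 2 √L`
    have hLm : (L : ℝ) ≤ (((2 * ∏ p ∈ t, p : ℕ) : ℝ)) ^ 2 := by
      exact_mod_cast (not_le.mp hmL).le
    have hsqm : Real.sqrt L ≤ ((2 * ∏ p ∈ t, p : ℕ) : ℝ) := by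
      rw [Real.sqrt_le_left hm0r.le]; exact hLm
    have hquot : (L : ℝ) / ((2 * ∏ p ∈ t, p : ℕ) : ℝ) + 1 ≤ 2 * Real.sqrt L := by
      have h1 : (L : ℝ) / ((2 * ∏ p ∈ t, p : ℕ) : ℝ) ≤ Real.sqrt L := by
        rw [div_le_iff₀ hm0r]
        calc (L : ℝ) = Real.sqrt L * Real.sqrt L := (Real.mul_self_sqrt hL0.le).symm
          _ ≤ Real.sqrt L * ((2 * ∏ p ∈ t, p : ℕ) : ℝ) :=
              mul_le_mul_of_nonneg_left hsqm (Real.sqrt_nonneg _)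
      linarith only [h1, hsL1]
    have hcnt0 : 0 ≤ (L : ℝ) * 3 ^ (#t + 1) := mul_nonneg hL0.le (pow_nonneg zero_le_three _)
    have hcnt : (L : ℝ) * 3 ^ (#t + 1) * ((L : ℝ) / ((2 * ∏ p ∈ t, p : ℕ) : ℝ) + 1) ≤
        (L : ℝ) * (2 * Real.sqrt L) * 3 ^ (#t + 1) := by
      calc (L : ℝ) * 3 ^ (#t + 1) * ((L : ℝ) / ((2 * ∏ p ∈ t, p : ℕ) : ℝ) + 1)
          ≤ (L : ℝ) * 3 ^ (#t + 1) * (2 * Real.sqrt L) := mul_le_mul_of_nonneg_left hquot hcnt0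
        _ = (L : ℝ) * (2 * Real.sqrt L) * 3 ^ (#t + 1) := by ring
    have hcnt0' : 0 ≤ (L : ℝ) * 3 ^ (#t + 1) * ((L : ℝ) / ((2 * ∏ p ∈ t, p : ℕ) : ℝ) + 1) :=
      mul_nonneg hcnt0 (add_nonneg (div_nonneg hL0.le hm0r.le) zero_le_one)
    have hA : ∀ r ∈ range (2 * ∏ p ∈ t, p),
        ∑ k ∈ (Icc 1 N).filter (fun k : ℕ => k ≡ r [MOD 2 * ∏ p ∈ t, p]), hbWeight c N k ≤
          cA * 3 ^ (#t + 1) := by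
      intro r _
      refine (sum_hbWeight_modEq_le_crude ht hL1 r).trans ?_
      have h := mul_le_mul_of_nonneg_left hcnt hN13
      rw [hcA]
      refine h.trans (le_of_eq ?_)
      ring
    have hB : ∀ r ∈ range (2 * ∏ p ∈ t, p),
        ∑ k ∈ (Icc 1 N).filter (fun k : ℕ => k ≡ r [MOD 2 * ∏ p ∈ t, p]), ut k ≤
          cB * 3 ^ (#t + 1) := by
      intro r _
      refine (sum_boxModel_modEq_le_crude (primesProdBelow z) ht hU0 hR0.le hval r).trans ?_
      have h := mul_le_mul hUR hcnt hcnt0' hUR0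
      rw [hcB]
      refine h.trans (le_of_eq ?_)
      ring
    have hA0 : ∀ r ∈ range (2 * ∏ p ∈ t, p),
        0 ≤ ∑ k ∈ (Icc 1 N).filter (fun k : ℕ => k ≡ r [MOD 2 * ∏ p ∈ t, p]), hbWeight c N k :=
      fun r _ => sum_nonneg fun k _ => hbWeight_nonneg c N k
    have hB0 : ∀ r ∈ range (2 * ∏ p ∈ t, p),
        0 ≤ ∑ k ∈ (Icc 1 N).filter (fun k : ℕ => k ≡ r [MOD 2 * ∏ p ∈ t, p]), ut k :=
      fun r _ => sum_nonneg fun k _ => hut0 k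
    have hZ : ∑ r ∈ range (2 * ∏ p ∈ t, p),
        (∑ k ∈ (Icc 1 N).filter (fun k : ℕ => k ≡ r [MOD 2 * ∏ p ∈ t, p]), w k) ^ 2 ≤
        (cA + cB) * U * 3 ^ (#t + 1) := by
      have h := sum_sq_sub_le_of_le (range (2 * ∏ p ∈ t, p)) hA0 hA hB0 hB
      rw [hsumA _ hm0, hsumB _ hm0] at h
      have e : ∑ r ∈ range (2 * ∏ p ∈ t, p),
          (∑ k ∈ (Icc 1 N).filter (fun k : ℕ => k ≡ r [MOD 2 * ∏ p ∈ t, p]), w k) ^ 2 =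
          ∑ r ∈ range (2 * ∏ p ∈ t, p),
            (∑ k ∈ (Icc 1 N).filter (fun k : ℕ => k ≡ r [MOD 2 * ∏ p ∈ t, p]), hbWeight c N k -
              ∑ k ∈ (Icc 1 N).filter (fun k : ℕ => k ≡ r [MOD 2 * ∏ p ∈ t, p]), ut k) ^ 2 := by
        refine sum_congr rfl fun r _ => ?_
        rw [← sum_sub_distrib]
      rw [e]
      refine h.trans (le_of_eq ?_)
      ring
    have key : (∏ p ∈ t, (1 / ((p : ℝ) - 2))) * ∑ r ∈ range (2 * ∏ p ∈ t, p),
        (∑ k ∈ (Icc 1 N).filter (fun k : ℕ => k ≡ r [MOD 2 * ∏ p ∈ t, p]), w k) ^ 2 ≤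
        (∏ p ∈ t, (1 / ((p : ℝ) - 2))) * ((cA + cB) * U * 3 ^ (#t + 1)) :=
      mul_le_mul_of_nonneg_left hZ (ha0 t htS)
    have e1 : (∏ p ∈ t, (1 / ((p : ℝ) - 2))) * ((cA + cB) * U * 3 ^ (#t + 1)) =
        (cA + cB) * U * (3 * ∏ p ∈ t, ((3 : ℝ) / ((p : ℝ) - 2))) := by
      rw [← prod_inv_sub_two_mul_three_pow]; ring
    rw [e1] at key
    exact key
  have hR3sum : ∑ t ∈ (S'.powerset.filter (fun t => ¬ 2 * ∏ p ∈ t, p ≤ Q₀)).filter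
      (fun t => ¬ (2 * ∏ p ∈ t, p) ^ 2 ≤ L), F t ≤ (cA + cB) * U * (3 * z ^ 3) := by
    refine (sum_le_sum hR3t).trans ?_
    rw [← mul_sum]
    refine mul_le_mul_of_nonneg_left ?_ (mul_nonneg (add_nonneg hcA0 hcB0) hU0)
    rw [← mul_sum]
    refine mul_le_mul_of_nonneg_left ?_ zero_le_three
    have hsub : (S'.powerset.filter (fun t => ¬ 2 * ∏ p ∈ t, p ≤ Q₀)).filter
        (fun t => ¬ (2 * ∏ p ∈ t, p) ^ 2 ≤ L) ⊆ S'.powerset :=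
      (filter_subset _ _).trans (filter_subset _ _)
    refine (sum_le_sum_of_subset_of_nonneg hsub fun t ht _ =>
      prod_nonneg fun p hp => ?_).trans (sum_powerset_prod_three_div_le hz1)
    have := hS'3 p (mem_powerset.mp ht hp)
    exact div_nonneg zero_le_three (by linarith only [this])
  -- the three ranges together
  have hsplit : ∑ t ∈ S'.powerset, F t =
      ∑ t ∈ S'.powerset.filter (fun t => 2 * ∏ p ∈ t, p ≤ Q₀), F t +
        (∑ t ∈ (S'.powerset.filter (fun t => ¬ 2 * ∏ p ∈ t, p ≤ Q₀)).filter
            (fun t => (2 * ∏ p ∈ t, p) ^ 2 ≤ L), F t +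
          ∑ t ∈ (S'.powerset.filter (fun t => ¬ 2 * ∏ p ∈ t, p ≤ Q₀)).filter
            (fun t => ¬ (2 * ∏ p ∈ t, p) ^ 2 ≤ L), F t) := by
    rw [sum_filter_add_sum_filter_not, sum_filter_add_sum_filter_not]
  have hmain : (N : ℝ) * (∑ k ∈ Icc 1 N, ∑ k' ∈ Icc 1 N,
      w k * w k' * pairSingSeries B (2 * N) (max k k' - min k k')) ≤
      2 * (N : ℝ) * ∑ t ∈ S'.powerset, F t := by
    rw [h2]
    have e : (N : ℝ) * (pairSingConst B (2 * N) * ∑ t ∈ S'.powerset, F t) =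
        pairSingConst B (2 * N) * ((N : ℝ) * ∑ t ∈ S'.powerset, F t) := by ring
    rw [e, mul_assoc]
    exact mul_le_mul_of_nonneg_right hκz2 (mul_nonneg hN0.le hsumF0)
  rw [hsplit] at hmain
  -- budgets
  have hB1 : 2 * (N : ℝ) * ((Q₀ : ℝ) * ((Q₀ : ℝ) * (2 * M ^ 2 + 18 * θ₁ ^ 2 * U ^ 2))) ≤
      4 * (Q₀ : ℝ) ^ 2 * N * M ^ 2 + δ / 16 * U ^ 2 * N :=
    budget_one hN0.le hθ₁0.le hθ₁4 hθ₁δ hQ₀pos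
  have hB2 : 2 * (N : ℝ) * (3 * G * U ^ 2 * (C_tail / Real.sqrt ((Q₀ : ℝ) / 2))) ≤
      δ / 4 * U ^ 2 * N :=
    budget_two hN0.le hG0 hδ hsq0 hQ₀sqrt
  have hB3a : 2 * (N : ℝ) * (cA * U * (3 * z ^ 3)) ≤ δ / 8 * U ^ 2 * N := by
    refine budget_three hN0.le hU0 ?_
    have e : 6 * cA * z ^ 3 = 12 * z ^ 3 * (N : ℝ) ^ ((1 : ℝ) / 3) * Real.log N *
        ((L : ℝ) * Real.sqrt L) := by rw [hcA]; ring
    rw [e]; exact hr3.trans hUκ'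
  have hB3b : 2 * (N : ℝ) * (cB * U * (3 * z ^ 3)) ≤ δ / 8 * U ^ 2 * N := by
    refine budget_three hN0.le hU0 ?_
    have hsL : 1536 * CubicSieve.dimConst / δ * z ^ 6 ≤ Real.sqrt L := by
      refine (Real.le_sqrt (mul_nonneg (div_nonneg (mul_nonneg (by norm_num) hK.le) hδ.le)
        (pow_nonneg hz0.le 6)) hL0.le).mpr ?_
      rw [mul_pow, ← pow_mul]; exact hL6
    rw [hcB]
    exact budget_three_model hL0 hV0 hK hz0 hδ hU0 (Real.mul_self_sqrt hL0.le) hsL0 hV8 hsL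
  -- conclusion
  exact dispersion_final hV herr hmain hR1sum hR2sum hR3sum hB1 hB2 hB3a hB3b hN0.le
    (mul_nonneg hδ.le (mul_nonneg (sq_nonneg U) hN0.le))

/-- **The dispersion of the Heath-Brown weight against its box model** — VERBATIM the `let`-form of
the parity-ideate route `GoldbachHeathBrownDispersion` (crux «ModelDispersion»): for all `κ, δ > 0`
there is `Q₀` such that for all `c, B > 0` there are `C, N₀` with: for `N ≥ N₀` and every `M`, with
`X = hbX N`, `η = hbEta c N`, `P = roughPrimorial B (2N)`, Heath-Brown's box, `U = ∑_{k≤N} f₃(k)`,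
`R`, `ũ` the box model, if `κη²N ≤ U` and `|∑_{k≤N, k≡r (d)} f₃(k) − ρ(d,r) U| ≤ M` for all squarefree
`d ≤ Q₀` and `r < d`, then `∑_{n∈(N,2N]} (∑_{k≤N} (f₃(k) − ũ(k)) g(n−k))² ≤ δU²N + CNM²`.
[cite: BombieriFriedlanderIwaniecActa1986, §3 (the dispersion method); HalberstamRichert1974, Thm 2.5] -/
theorem boxModel_dispersion :
    ∀ κ δ : ℝ, 0 < κ → 0 < δ → ∃ Q₀ : ℕ, ∀ c B : ℝ, 0 < c → 0 < B → ∃ C : ℝ, ∃ N₀ : ℕ,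
      ∀ N : ℕ, N₀ ≤ N → ∀ M : ℝ,
      let X : ℝ := hbX N
      let η : ℝ := hbEta c N
      let P : ℕ := roughPrimorial B (2 * N)
      let box : Finset (ℕ × ℕ) := Finset.filter (fun xy : ℕ × ℕ => X < xy.1 ∧ (xy.1 : ℝ) ≤ X * (1 + η) ∧
        X < xy.2 ∧ (xy.2 : ℝ) ≤ X * (1 + η)) (Finset.Iic ⌊X * (1 + η)⌋₊ ×ˢ Finset.Iic ⌊X * (1 + η)⌋₊)
      let U : ℝ := ∑ k ∈ Finset.Icc 1 N, hbWeight c N k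
      let R : ℝ := ((Finset.filter (fun xy : ℕ × ℕ => Nat.Coprime (xy.1 ^ 3 + 2 * xy.2 ^ 3) P) box).card : ℝ)
      let ũ : ℕ → ℝ := fun m => U / R *
        ((Finset.filter (fun xy : ℕ × ℕ => xy.1 ^ 3 + 2 * xy.2 ^ 3 = m ∧ Nat.Coprime m P) box).card : ℝ)
      κ * η ^ 2 * N ≤ U →
      (∀ d : ℕ, 0 < d → d ≤ Q₀ → Squarefree d → ∀ r : ℕ, r < d →
        |(∑ k ∈ Finset.filter (fun k : ℕ => k ≡ r [MOD d]) (Finset.Icc 1 N), hbWeight c N k) -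
            ((Finset.filter (fun xy : ℕ × ℕ => xy.1 ^ 3 + 2 * xy.2 ^ 3 ≡ r [MOD d] ∧
                Nat.Coprime (xy.1 ^ 3 + 2 * xy.2 ^ 3) d) (Finset.range d ×ˢ Finset.range d)).card : ℝ) /
              ((Finset.filter (fun xy : ℕ × ℕ => Nat.Coprime (xy.1 ^ 3 + 2 * xy.2 ^ 3) d)
                (Finset.range d ×ˢ Finset.range d)).card : ℝ) * U| ≤ M) →
      ∑ n ∈ Finset.Ioc N (2 * N), (∑ k ∈ Finset.Icc 1 N, (hbWeight c N k - ũ k) *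
        roughModel B (2 * N) (n - k)) ^ 2 ≤ δ * U ^ 2 * N + C * N * M ^ 2 := by
  intro κ δ hκ hδ
  obtain ⟨Q₀, h⟩ := boxModel_dispersion' κ δ hκ hδ
  refine ⟨Q₀, fun c B hc hB => ?_⟩
  obtain ⟨C, N₀, h'⟩ := h c B hc hB
  exact ⟨C, N₀, fun N hN M hU hhyp => h' N hN M hU hhyp⟩

end Literature.NumberTheory.Sieve.CubicMinorant

end
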